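import Literature.MathematicalPhysics.QuantumManyBody.LiebYngvasonBoxBound
import Literature.MathematicalPhysics.QuantumManyBody.PeriodicBoseGasLocalization
import Mathlib.MeasureTheory.Constructions.HaarToSphere
import Mathlib.MeasureTheory.Measure.Lebesgue.VolumeOfBalls
import Mathlib.Analysis.SpecialFunctions.SmoothTransition
import Mathlib.Analysis.InnerProductSpace.Calculus
import Mathlib.Analysis.Calculus.ContDiff.Deriv
import Mathlib.Analysis.Calculus.LocalExtr.Basic
import Mathlib.Analysis.SpecialFunctions.Sqrt
import Mathlib.MeasureTheory.Integral.IntervalIntegral.FundThmCalculus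
import Mathlib.Analysis.Calculus.MeanValue
import Mathlib.Analysis.Calculus.FDeriv.Measurable
import HarnessLib

/-!
# Dyson's lemma: `H_n ≥ a W_R` in a Neumann box (LSSY Lemma 2.5 and Corollary 2.6)

Topic `Literature/MathematicalPhysics/QuantumManyBody`, sibling of `LiebYngvasonBoxBound.lean`
(provefact `Literature.MathematicalPhysics.QuantumManyBody.BoseGas.LSSY2005_lowerBound_dirichlet`). This file discharges the named fact
`LSSY2005_dysonBound_boxN` of `LiebYngvasonBoxBound.lean` — the quadratic-form version of
[LSSY2005, Cor. 2.6]: for `v ≥ 0` measurable of finite range `R₀`, `R > R₀` and every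
`ψ ∈ C¹((ℝ³)^n)`,
`a ∫_{Λ^n} W_R |ψ|² ≤ ∫_{Λ^n} (|∇ψ|² + ∑_{i<j} v(|xᵢ - xⱼ|)|ψ|²)`, `W_R = ∑ᵢ U_R(tᵢ)` — from the
variational definition of the scattering length (`scatteringLength`, [LSSY2005, App. C]).
Everything is done with `ℝ≥0∞`-valued lower Lebesgue integrals, so that hard cores (`v = ⊤`)
need no separate treatment and Tonelli's theorem applies without integrability provisos.

## The argument (as printed, with the variational principle replacing the scattering equation)

* **Polar coordinates** (`lintegral_eq_lintegral_sphere`, `lintegral_radial`): Mathlib's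
  `measurePreserving_homeomorphUnitSphereProd`, `dim ℝ³ = 3`, `σ(S²) = 4π` for
  `σ = volume.toSphere` (written inline; cf. `Hilbert6.sphereMeasure`).
* **Radial trial functions** (`scatteringLength_le_radial`): for `g ∈ C¹` vanishing near `0`
  and `= 1` on `[S,∞)`, `x ↦ g(|x|)` is admissible, so `a ≤ ∫_0^∞ (g'² + ½ v g²) r² dr`
  [LSSY2005, Thm. C.1 (C.4)].
* **The core bound** (`core_real`, `core`) — (2.38) for the `δ`-shell: for `f ∈ C¹` and
  `R' > R₀`, `a |f(R')|² ≤ ∫_0^{R'} (|f'|² + ½ v|f|²) r² dr`. The source minimises the left side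
  of (2.38) and solves the scattering equation; here we feed the variational principle the
  competitor `g = χ(r/η) (f + ρ((r-R')/τ)(f(R') - f)) / f(R')` (`competitor`; `χ`, `ρ` smooth
  transitions): on `(0,η)` the multiplicative cutoff costs `O(η) + 2∫_0^η` thanks to the weight
  `r²` (and can only lower the potential energy — this is where `v = ⊤` is harmless), on
  `[η,R')` the competitor is `f/f(R')`, on `[R',R'+τ)` the potential vanishes and `|g'|` is
  bounded, beyond it `g = 1`; then `η, τ → 0` (`scatteringLength_le_competitor`).
* **Superposition** (`ray_bound`) — "every `U` is a superposition of `δ`-functions": on a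
  star-shaped set of radii, multiply the core bound by `U_R(R')R'²` and integrate, using
  `∫ U_R r² dr = 1` (`lintegral_dysonPotential_mul_sq`).
* **Lemma 2.5** (`lemma25_zero`, `lemma25`): for `C ⊆ ℝ³` measurable and star-shaped with
  respect to `p`, `a ∫_C U_R(|x-p|)|ψ|² ≤ ∫_C (|∇ψ|² + ½ v(|x-p|)|ψ|²)`, by polar coordinates about
  `p` and the bound `|∂_r ψ|² ≤ |∇ψ|²` (`nnnorm_fderiv_apply_sq_le_gradSqC`; `|∇ψ|²` is the
  existing `gradSqC`).
* **Corollary 2.6** (`slice_bound`, `particle_bound`, `LSSY2005_dysonBound_boxN_holds`): for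
  each `i`, freeze the other particles (`glueEquiv (singleEmb i) 0` of the cell method, Fubini:
  `setLIntegral_boxN_eq_glue`), cut `Λ_ℓ` into the Voronoi
  cells of the other particles (`vcell`, ties broken by the index so that the cells partition
  `Λ_ℓ` exactly; they are convex, `vcell_star`), apply Lemma 2.5 in each cell keeping only the
  nearest-neighbour term `½ v(|xᵢ - x_{j(i)}|)`, and sum: `∑ᵢ ½ ∑_{j≠i} v = ∑_{i<j} v`
  (`sum_sum_erase_eq_two_mul_interaction`).

## References

* [LSSY2005] E. H. Lieb, R. Seiringer, J. P. Solovej, J. Yngvason, *The Mathematics of the Bose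
  Gas and its Condensation*, Oberwolfach Seminars 34, Birkhäuser 2005 (arXiv:cond-mat/0610117):
  Lemma 2.5 (2.36)–(2.39) and Cor. 2.6 (2.40)–(2.43), p. 14; (2.44) (softU), p. 15; App. C,
  Thm. C.1 (C.4).
* F. J. Dyson, *Ground-state energy of a hard-sphere gas*, Phys. Rev. 106 (1957) 20–26,
  Lemma 1 and eq. (28) (the original lemma for hard spheres).
-/

noncomputable section

open MeasureTheory Filter Metric Set
open scoped ENNReal NNReal Topology RealInnerProductSpace Real

namespace Literature.MathematicalPhysics.QuantumManyBody.BoseGas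

namespace Dyson

/-! ### Small `ℝ≥0∞` helpers -/

/-- `‖x‖₊² = ofReal (x²)` for real `x`. [folklore] -/
theorem nnnorm_sq_real (x : ℝ) : ((‖x‖₊ : ℝ≥0∞)) ^ 2 = ENNReal.ofReal (x ^ 2) := by
  rw [← enorm_eq_nnnorm, ← ofReal_norm, ← ENNReal.ofReal_pow (norm_nonneg _), Real.norm_eq_abs,
    sq_abs]

/-- `‖z‖₊² = ofReal ‖z‖²`. [folklore] -/
theorem nnnorm_sq_eq_ofReal {F : Type*} [NormedAddCommGroup F] (z : F) :
    ((‖z‖₊ : ℝ≥0∞)) ^ 2 = ENNReal.ofReal (‖z‖ ^ 2) := by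
  rw [← enorm_eq_nnnorm, ← ofReal_norm, ← ENNReal.ofReal_pow (norm_nonneg _)]

/-! ### Polar coordinates in `ℝ³` for lower Lebesgue integrals -/

/-- `dim ℝ³ = 3`. [folklore] -/
theorem finrank_space : Module.finrank ℝ Space = 3 := finrank_euclideanSpace_fin

/-- The surface measure `σ` on the unit sphere `S² ⊂ ℝ³` induced by Lebesgue measure
(`volume.toSphere`, of total mass `4π`; cf. `Hilbert6.sphereMeasure` in `KineticTheory`). -/
local notation "sphereVol" => (Measure.toSphere (volume : Measure Space))

/-- **Polar coordinates**: `∫_{ℝ³} G = ∫_{S²} dσ(ω) ∫_0^∞ G(rω) r² dr` for measurable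
`G : ℝ³ → [0,∞]`. [folklore] -/
theorem lintegral_eq_lintegral_sphere (G : Space → ℝ≥0∞) (hG : Measurable G) :
    ∫⁻ x, G x = ∫⁻ ω : sphere (0 : Space) 1,
      (∫⁻ r in Ioi (0 : ℝ), G (r • (ω : Space)) * ENNReal.ofReal (r ^ 2)) ∂sphereVol := by
  set e := homeomorphUnitSphereProd Space with he
  have hmp := Measure.measurePreserving_homeomorphUnitSphereProd (volume : Measure Space)
  rw [finrank_space] at hmp
  calc ∫⁻ x, G x = ∫⁻ x in ({0}ᶜ : Set Space), G x := by rw [restrict_compl_singleton]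
    _ = ∫⁻ x : ({0}ᶜ : Set Space), G x ∂(volume.comap Subtype.val) :=
        (lintegral_subtype_comap (measurableSet_singleton (0 : Space)).compl G).symm
    _ = ∫⁻ x : ({0}ᶜ : Set Space), (G ∘ Subtype.val ∘ e.symm) (e x)
          ∂(volume.comap Subtype.val) := by
        simp
    _ = ∫⁻ q, (G ∘ Subtype.val ∘ e.symm) q
          ∂((volume : Measure Space).toSphere.prod (Measure.volumeIoiPow (3 - 1))) :=
        hmp.lintegral_comp_emb e.measurableEmbedding _
    _ = ∫⁻ ω : sphere (0 : Space) 1, (∫⁻ r : Ioi (0 : ℝ), G ((r : ℝ) • (ω : Space))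
          ∂(Measure.volumeIoiPow 2)) ∂sphereVol := by
        rw [lintegral_prod _ (Measurable.aemeasurable ?_)]
        · simp [he, homeomorphUnitSphereProd]
        · exact hG.comp (measurable_subtype_coe.comp e.symm.measurable)
    _ = _ := by
        refine lintegral_congr fun ω => ?_
        have hm : Measurable fun r : Ioi (0 : ℝ) => G ((r : ℝ) • (ω : Space)) :=
          hG.comp (measurable_subtype_coe.smul_const _)
        rw [Measure.volumeIoiPow, lintegral_withDensity_eq_lintegral_mul _ (by fun_prop) hm,
          ← lintegral_subtype_comap measurableSet_Ioi
            (fun r : ℝ => G (r • (ω : Space)) * ENNReal.ofReal (r ^ 2))]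
        refine lintegral_congr fun r => ?_
        simp [mul_comm]

/-- The total mass of `σ` on `S² ⊂ ℝ³` is `4π`. [folklore] -/
theorem toSphere_volume_univ : sphereVol univ = ENNReal.ofReal (4 * π) := by
  rw [Measure.toSphere_apply_univ, finrank_space, EuclideanSpace.volume_ball_fin_three]
  rw [ENNReal.ofReal_one, one_pow, one_mul, show ((3 : ℕ) : ℝ≥0∞) = ENNReal.ofReal 3 by simp,
    ← ENNReal.ofReal_mul (by norm_num)]
  congr 1
  ring

/-- **Radial functions**: `∫_{ℝ³} F(|x|) dx = 4π ∫_0^∞ F(r) r² dr`. [folklore] -/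
theorem lintegral_radial (F : ℝ → ℝ≥0∞) (hF : Measurable F) :
    ∫⁻ x : Space, F ‖x‖ =
      ENNReal.ofReal (4 * π) * ∫⁻ r in Ioi (0 : ℝ), F r * ENNReal.ofReal (r ^ 2) := by
  rw [lintegral_eq_lintegral_sphere (fun x => F ‖x‖) (hF.comp measurable_norm)]
  have : ∀ ω : sphere (0 : Space) 1,
      ∫⁻ r in Ioi (0 : ℝ), F ‖r • (ω : Space)‖ * ENNReal.ofReal (r ^ 2) =
        ∫⁻ r in Ioi (0 : ℝ), F r * ENNReal.ofReal (r ^ 2) := by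
    intro ω
    refine setLIntegral_congr_fun measurableSet_Ioi fun r hr => ?_
    rw [norm_smul, Real.norm_of_nonneg (le_of_lt hr), mem_sphere_zero_iff_norm.1 ω.2, mul_one]
  simp_rw [this]
  rw [lintegral_const, toSphere_volume_univ, mul_comm]

/-! ### Radial trial functions for the scattering length -/

section Radial

/-- The derivative of the Euclidean norm away from the origin: `D‖·‖(x) = ⟨x/‖x‖, ·⟩`.
[folklore] -/
theorem hasFDerivAt_norm_space {x : Space} (hx : x ≠ 0) :
    HasFDerivAt (fun y : Space => ‖y‖) (‖x‖⁻¹ • innerSL ℝ x) x := by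
  have h1 : HasFDerivAt (fun y : Space => ‖y‖ ^ 2) (2 • innerSL ℝ x) x :=
    (hasStrictFDerivAt_norm_sq x).hasFDerivAt
  have hx2 : ‖x‖ ^ 2 ≠ 0 := by positivity
  have h2 : HasDerivAt Real.sqrt (1 / (2 * Real.sqrt (‖x‖ ^ 2))) (‖x‖ ^ 2) :=
    Real.hasDerivAt_sqrt hx2
  have h3 := h2.comp_hasFDerivAt x h1
  have heq : (Real.sqrt ∘ fun y : Space => ‖y‖ ^ 2) = fun y => ‖y‖ :=
    funext fun y => Real.sqrt_sq (norm_nonneg _)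
  rw [heq, Real.sqrt_sq (norm_nonneg _)] at h3
  refine h3.congr_fderiv ?_
  have : ‖x‖ ≠ 0 := norm_ne_zero_iff.2 hx
  ext v
  simp only [FunLike.coe_smul, Pi.smul_apply, innerSL_apply_apply, nsmul_eq_mul, smul_eq_mul]
  field_simp
  norm_num

/-- For a radial `C¹` profile `g`, the squared gradient of `x ↦ g(‖x‖)` away from the origin is
`g'(‖x‖)²`. [folklore] -/
theorem gradSq_radial {g : ℝ → ℝ} (hg : ContDiff ℝ 1 g) {x : Space} (hx : x ≠ 0) :
    gradSq (fun y : Space => g ‖y‖) x = ((‖deriv g ‖x‖‖₊ : ℝ≥0∞)) ^ 2 := by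
  have hd : HasFDerivAt (fun y : Space => g ‖y‖)
      (deriv g ‖x‖ • (‖x‖⁻¹ • innerSL ℝ x)) x :=
    ((hg.differentiable one_ne_zero) ‖x‖).hasDerivAt.comp_hasFDerivAt x
      (hasFDerivAt_norm_space hx)
  unfold gradSq
  rw [hd.fderiv]
  simp only [FunLike.coe_smul, Pi.smul_apply, innerSL_apply_apply,
    EuclideanSpace.inner_single_right,
    smul_eq_mul, one_mul]
  simp only [conj_trivial, nnnorm_sq_real]
  rw [← ENNReal.ofReal_sum_of_nonneg (fun k _ => by positivity)]
  congr 1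
  have hn : ‖x‖ ≠ 0 := norm_ne_zero_iff.2 hx
  have hsum : ∑ k : Fin 3, (x k) ^ 2 = ‖x‖ ^ 2 := by
    rw [EuclideanSpace.norm_eq, Real.sq_sqrt (Finset.sum_nonneg fun k _ => by positivity)]
    exact Finset.sum_congr rfl fun k _ => by rw [Real.norm_eq_abs, sq_abs]
  calc ∑ k : Fin 3, (deriv g ‖x‖ * (‖x‖⁻¹ * x k)) ^ 2
      = (deriv g ‖x‖) ^ 2 * ‖x‖⁻¹ ^ 2 * ∑ k : Fin 3, (x k) ^ 2 := by
        rw [Finset.mul_sum]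
        exact Finset.sum_congr rfl fun k _ => by ring
    _ = (deriv g ‖x‖) ^ 2 := by
        rw [hsum]
        field_simp

/-- **Radial trial functions.** If `g ∈ C¹(ℝ)` vanishes near `0` and equals `1` on `[S, ∞)`, then
`x ↦ g(|x|)` is an admissible trial function for the scattering length and, by polar coordinates,
`a ≤ ∫_0^∞ (g'(r)² + ½ v(r) g(r)²) r² dr`. [cite: LSSY2005, App. C Thm. C.1 (C.4)] -/
theorem scatteringLength_le_radial (v : ℝ → ℝ≥0∞) (hv : Measurable v) {g : ℝ → ℝ}
    (hg : ContDiff ℝ 1 g) (h0 : ∀ᶠ r in 𝓝 0, g r = 0) {S : ℝ} (h1 : ∀ r, S ≤ r → g r = 1) :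
    scatteringLength v ≤ ∫⁻ r in Ioi (0 : ℝ),
      (((‖deriv g r‖₊ : ℝ≥0∞)) ^ 2 + 2⁻¹ * v r * ((‖g r‖₊ : ℝ≥0∞)) ^ 2) *
        ENNReal.ofReal (r ^ 2) := by
  set φ : Space → ℝ := fun x => g ‖x‖ with hφ
  have hφ0 : ∀ᶠ x in 𝓝 (0 : Space), φ x = (fun _ => (0 : ℝ)) x := by
    have : Tendsto (fun x : Space => ‖x‖) (𝓝 0) (𝓝 0) := by
      simpa using (continuous_norm (E := Space)).tendsto 0
    exact this.eventually h0
  have hφd : ContDiff ℝ 1 φ := by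
    rw [contDiff_iff_contDiffAt]
    intro x
    by_cases hx : x = 0
    · subst hx
      exact (contDiffAt_const (c := (0 : ℝ))).congr_of_eventuallyEq hφ0
    · exact hg.contDiffAt.comp x (contDiffAt_norm ℝ hx)
  have htrial : IsScatteringTrial φ := by
    refine ⟨hφd, HasCompactSupport.intro (isCompact_closedBall (0 : Space) S) fun x hx => ?_⟩
    simp only [mem_closedBall, dist_zero_right, not_le] at hx
    simp [hφ, h1 _ hx.le]
  set G : ℝ → ℝ≥0∞ := fun r =>
    ((‖deriv g r‖₊ : ℝ≥0∞)) ^ 2 + 2⁻¹ * v r * ((‖g r‖₊ : ℝ≥0∞)) ^ 2 with hG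
  have hGm : Measurable G := by
    have h1m : Measurable (deriv g) := hg.continuous_deriv_one.measurable
    have h2m : Measurable g := hg.continuous.measurable
    fun_prop
  have hfun : scatteringFunctional v φ = ∫⁻ x : Space, G ‖x‖ := by
    refine lintegral_congr_ae ?_
    filter_upwards [Measure.ae_ne volume (0 : Space)] with x hx
    rw [gradSq_radial hg hx]
  have h4 : ENNReal.ofReal (4 * π) ≠ 0 := (ENNReal.ofReal_pos.2 (by positivity)).ne'
  calc scatteringLength v
      ≤ (ENNReal.ofReal (4 * π))⁻¹ * scatteringFunctional v φ := scatteringLength_le htrial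
    _ = (ENNReal.ofReal (4 * π))⁻¹ *
          (ENNReal.ofReal (4 * π) * ∫⁻ r in Ioi (0 : ℝ), G r * ENNReal.ofReal (r ^ 2)) := by
        rw [hfun, lintegral_radial G hGm]
    _ = ∫⁻ r in Ioi (0 : ℝ), G r * ENNReal.ofReal (r ^ 2) := by
        rw [← mul_assoc, ENNReal.inv_mul_cancel h4 ENNReal.ofReal_ne_top, one_mul]

end Radial

/-! ### Smooth cutoffs -/

section Cutoff

/-- The transition function `ρ = Real.smoothTransition` (`0` on `(-∞,0]`, `1` on `[1,∞)`,
`C^∞`, values in `[0,1]`). [folklore] -/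
abbrev ρ : ℝ → ℝ := Real.smoothTransition

/-- `ρ` is `C¹`. [folklore] -/
theorem ρ_contDiff : ContDiff ℝ 1 ρ := Real.smoothTransition.contDiff (n := 1)

/-- `ρ' = 0` on `(-∞, 0]` (local minimum). [folklore] -/
theorem deriv_ρ_of_nonpos {t : ℝ} (ht : t ≤ 0) : deriv ρ t = 0 :=
  IsLocalMin.deriv_eq_zero (Eventually.of_forall fun s => by
    rw [show ρ t = 0 from Real.smoothTransition.zero_of_nonpos ht]
    exact Real.smoothTransition.nonneg s)

/-- `ρ' = 0` on `[1, ∞)` (local maximum). [folklore] -/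
theorem deriv_ρ_of_one_le {t : ℝ} (ht : 1 ≤ t) : deriv ρ t = 0 :=
  IsLocalMax.deriv_eq_zero (Eventually.of_forall fun s => by
    rw [show ρ t = 1 from Real.smoothTransition.one_of_one_le ht]
    exact Real.smoothTransition.le_one s)

/-- `ρ'` is bounded. [folklore] -/
theorem exists_bound_deriv_ρ : ∃ M, 0 ≤ M ∧ ∀ t, |deriv ρ t| ≤ M := by
  obtain ⟨M, hM⟩ := isCompact_Icc.exists_bound_of_continuousOn
    (ρ_contDiff.continuous_deriv_one.continuousOn (s := Icc (0 : ℝ) 1))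
  have hM0 : 0 ≤ M := (norm_nonneg _).trans (hM 0 ⟨le_rfl, zero_le_one⟩)
  refine ⟨M, hM0, fun t => ?_⟩
  rcases le_or_gt t 0 with h | h
  · rw [deriv_ρ_of_nonpos h, abs_zero]; exact hM0
  rcases le_or_gt 1 t with h' | h'
  · rw [deriv_ρ_of_one_le h', abs_zero]; exact hM0
  exact (Real.norm_eq_abs _).symm.le.trans (hM t ⟨h.le, h'.le⟩)

/-- The cutoff `χ(t) = ρ(2t - 1)`: `0` on `(-∞, ½]`, `1` on `[1, ∞)`. [folklore] -/
def χ (t : ℝ) : ℝ := ρ (2 * t - 1)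

/-- `χ` is `C¹`. [folklore] -/
theorem χ_contDiff : ContDiff ℝ 1 χ := ρ_contDiff.comp (by fun_prop)

/-- `χ = 0` on `(-∞, ½]`. [folklore] -/
theorem χ_of_le_half {t : ℝ} (ht : t ≤ 1 / 2) : χ t = 0 :=
  Real.smoothTransition.zero_of_nonpos (by linarith)

/-- `χ = 1` on `[1, ∞)`. [folklore] -/
theorem χ_of_one_le {t : ℝ} (ht : 1 ≤ t) : χ t = 1 :=
  Real.smoothTransition.one_of_one_le (by linarith)

/-- `0 ≤ χ ≤ 1`. [folklore] -/
theorem abs_χ_le_one (t : ℝ) : |χ t| ≤ 1 := by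
  rw [abs_le]
  have h0 : 0 ≤ χ t := Real.smoothTransition.nonneg (2 * t - 1)
  exact ⟨by linarith, Real.smoothTransition.le_one _⟩

/-- `χ' = 0` on `(-∞, ½]`. [folklore] -/
theorem deriv_χ_of_le_half {t : ℝ} (ht : t ≤ 1 / 2) : deriv χ t = 0 :=
  IsLocalMin.deriv_eq_zero (Eventually.of_forall fun s => by
    rw [χ_of_le_half ht]
    exact Real.smoothTransition.nonneg _)

/-- `χ' = 0` on `[1, ∞)`. [folklore] -/
theorem deriv_χ_of_one_le {t : ℝ} (ht : 1 ≤ t) : deriv χ t = 0 :=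
  IsLocalMax.deriv_eq_zero (Eventually.of_forall fun s => by
    rw [χ_of_one_le ht]
    exact Real.smoothTransition.le_one _)

/-- `χ'` is bounded. [folklore] -/
theorem exists_bound_deriv_χ : ∃ M, 0 ≤ M ∧ ∀ t, |deriv χ t| ≤ M := by
  obtain ⟨M, hM⟩ := isCompact_Icc.exists_bound_of_continuousOn
    (χ_contDiff.continuous_deriv_one.continuousOn (s := Icc (1 / 2 : ℝ) 1))
  have hM0 : 0 ≤ M := (norm_nonneg _).trans (hM 1 ⟨by norm_num, le_rfl⟩)
  refine ⟨M, hM0, fun t => ?_⟩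
  rcases le_or_gt t (1 / 2) with h | h
  · rw [deriv_χ_of_le_half h, abs_zero]; exact hM0
  rcases le_or_gt 1 t with h' | h'
  · rw [deriv_χ_of_one_le h', abs_zero]; exact hM0
  exact (Real.norm_eq_abs _).symm.le.trans (hM t ⟨h.le, h'.le⟩)

end Cutoff

/-! ### The radial energy density -/

section Energy

variable (v : ℝ → ℝ≥0∞)

/-- The radial energy density `(h'(r)² + ½ v(r) h(r)²) r²` of a real profile `h`.
[cite: LSSY2005, (2.38)] -/
def edens (h : ℝ → ℝ) (r : ℝ) : ℝ≥0∞ :=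
  (ENNReal.ofReal (deriv h r ^ 2) + 2⁻¹ * v r * ENNReal.ofReal (h r ^ 2)) * ENNReal.ofReal (r ^ 2)

variable {v}

/-- The energy density is measurable (for measurable `v` and continuous `h`). [folklore] -/
theorem measurable_edens (hv : Measurable v) {h : ℝ → ℝ} (hh : Continuous h) :
    Measurable (edens v h) := by
  unfold edens
  have h1 : Measurable (deriv h) := measurable_deriv h
  have h2 : Measurable h := hh.measurable
  fun_prop

/-- Part A in terms of `edens`: for a `C¹` profile `g` vanishing near `0` and equal to `1` on
`[S,∞)`, `a ≤ ∫_0^∞ edens(g)`. [cite: LSSY2005, App. C Thm. C.1 (C.4)] -/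
theorem scatteringLength_le_lintegral_edens (hv : Measurable v) {g : ℝ → ℝ}
    (hg : ContDiff ℝ 1 g) (h0 : ∀ᶠ r in 𝓝 0, g r = 0) {S : ℝ} (h1 : ∀ r, S ≤ r → g r = 1) :
    scatteringLength v ≤ ∫⁻ r in Ioi (0 : ℝ), edens v g r := by
  refine (scatteringLength_le_radial v hv hg h0 h1).trans (le_of_eq ?_)
  refine lintegral_congr fun r => ?_
  simp only [edens, nnnorm_sq_real]

end Energy

/-! ### The competitor and its energy -/

section Competitor

variable {v : ℝ → ℝ≥0∞} {R₀ R' : ℝ} {f : ℝ → ℝ}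

/-- The competitor built from a ray profile `f` with `f(R') ≠ 0`: cut off multiplicatively near
the origin at scale `η`, normalised by `f(R')`, and blended to the constant `1` on `[R', R'+τ]`:
`g(r) = χ(r/η) (f(r) + ρ((r-R')/τ)(f(R') - f(r))) / f(R')`. [folklore] -/
def competitor (f : ℝ → ℝ) (R' η τ : ℝ) (r : ℝ) : ℝ :=
  χ (r / η) * (f r + ρ ((r - R') / τ) * (f R' - f r)) / f R'

/-- The competitor is `C¹`. [folklore] -/
theorem competitor_contDiff (hf : ContDiff ℝ 1 f) (R' η τ : ℝ) :
    ContDiff ℝ 1 (competitor f R' η τ) := by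
  unfold competitor
  exact ((χ_contDiff.comp (contDiff_id.div_const η)).mul (hf.add
    ((ρ_contDiff.comp ((contDiff_id.sub contDiff_const).div_const τ)).mul
      (contDiff_const.sub hf)))).div_const (f R')

/-- **Energy of the competitor.** With `c = f(R') ≠ 0`, `0 < η < R'`, `0 < τ ≤ 1`:
`a ≤ ∫_0^∞ edens(g) ≤ 2(M_χ M_f/c)² η + 2c⁻² ∫_0^η edens(f) + c⁻² ∫_0^{R'} edens(f)
+ ((M₁ + M_ρ M₁)/|c|)² (R'+1)² τ`, where `M_f` bounds `|f|` on `[0,R']`, `M₁` bounds `|f'|` on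
`[R', R'+1]`, `M_χ`, `M_ρ` bound `|χ'|`, `|ρ'|`: on `(0,η)` the cutoff costs `O(η)` thanks to the
weight `r²`, on `[η, R')` the competitor is `f/c` exactly, on `[R', R'+τ)` the potential vanishes
and `|g'|` is bounded, and beyond `R'+τ` the competitor is `1`.
[cite: LSSY2005, Lemma 2.5, (2.38)–(2.39)] -/
theorem scatteringLength_le_competitor (hv : Measurable v) (hR₀ : 0 ≤ R₀)
    (hvan : ∀ r, R₀ < r → v r = 0) (hf : ContDiff ℝ 1 f) (hR' : R₀ < R') (hc : f R' ≠ 0)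
    {Mf M₁ Mχ Mρ : ℝ} (hMf : ∀ r ∈ Icc 0 R', |f r| ≤ Mf)
    (hM₁ : ∀ r ∈ Icc R' (R' + 1), |deriv f r| ≤ M₁)
    (hMχ : ∀ t, |deriv χ t| ≤ Mχ) (hMρ : ∀ t, |deriv ρ t| ≤ Mρ) (hMρ0 : 0 ≤ Mρ)
    {η τ : ℝ} (hη : 0 < η) (hηR : η < R') (hτ : 0 < τ) (hτ1 : τ ≤ 1) :
    scatteringLength v ≤
      ENNReal.ofReal (2 * (Mχ * Mf / f R') ^ 2 * η) +
        ENNReal.ofReal (2 * (f R')⁻¹ ^ 2) * (∫⁻ r in Ioo 0 η, edens v f r) +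
        ENNReal.ofReal ((f R')⁻¹ ^ 2) * (∫⁻ r in Ioo 0 R', edens v f r) +
        ENNReal.ofReal (((M₁ + Mρ * M₁) / |f R'|) ^ 2 * (R' + 1) ^ 2 * τ) := by
  set c := f R' with hc_def
  have hR'pos : 0 < R' := hR₀.trans_lt hR'
  have hMf0 : 0 ≤ Mf := (abs_nonneg _).trans (hMf 0 ⟨le_rfl, hR'pos.le⟩)
  have hM₁0 : 0 ≤ M₁ := (abs_nonneg _).trans (hM₁ R' ⟨le_rfl, by linarith⟩)
  have hMχ0 : 0 ≤ Mχ := (abs_nonneg _).trans (hMχ 0)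
  set g : ℝ → ℝ := competitor f R' η τ with hg_def
  -- the pieces of `g` and their derivatives
  set k : ℝ → ℝ := fun r => f r + ρ ((r - R') / τ) * (c - f r) with hk
  set k' : ℝ → ℝ := fun r =>
    deriv f r + (deriv ρ ((r - R') / τ) * τ⁻¹ * (c - f r) - ρ ((r - R') / τ) * deriv f r) with hk'
  set g' : ℝ → ℝ := fun r => (deriv χ (r / η) * η⁻¹ * k r + χ (r / η) * k' r) / c with hg'
  have hg_eq : ∀ r, g r = χ (r / η) * k r / c := fun r => rfl
  have hfd : ∀ r, HasDerivAt f (deriv f r) r := fun r =>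
    (hf.differentiable one_ne_zero r).hasDerivAt
  have hρd : ∀ t, HasDerivAt ρ (deriv ρ t) t := fun t =>
    (ρ_contDiff.differentiable one_ne_zero t).hasDerivAt
  have hχd : ∀ t, HasDerivAt χ (deriv χ t) t := fun t =>
    (χ_contDiff.differentiable one_ne_zero t).hasDerivAt
  have hkd : ∀ r, HasDerivAt k (k' r) r := by
    intro r
    have h1 : HasDerivAt (fun r => (r - R') / τ) τ⁻¹ r := by
      simpa [one_div] using ((hasDerivAt_id r).sub_const R').div_const τ
    have h2 : HasDerivAt (fun r => ρ ((r - R') / τ)) (deriv ρ ((r - R') / τ) * τ⁻¹) r :=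
      (hρd _).comp r h1
    have h3 : HasDerivAt (fun r => c - f r) (-deriv f r) r := by
      simpa using (hfd r).const_sub c
    refine ((hfd r).add (h2.mul h3)).congr_deriv ?_
    simp only [hk']
    ring
  have hgd : ∀ r, HasDerivAt g (g' r) r := by
    intro r
    have h1 : HasDerivAt (fun r => r / η) η⁻¹ r := by
      simpa [one_div] using (hasDerivAt_id r).div_const η
    have h2 : HasDerivAt (fun r => χ (r / η)) (deriv χ (r / η) * η⁻¹) r := (hχd _).comp r h1
    have h3 : HasDerivAt (fun r => χ (r / η) * k r / c)
        ((deriv χ (r / η) * η⁻¹ * k r + χ (r / η) * k' r) / c) r := (h2.mul (hkd r)).div_const c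
    exact h3
  have hderiv : ∀ r, deriv g r = g' r := fun r => (hgd r).deriv
  -- values of the cutoffs on the regions
  have hρ0 : ∀ r, r ≤ R' → ρ ((r - R') / τ) = 0 := fun r hr =>
    Real.smoothTransition.zero_of_nonpos (div_nonpos_of_nonpos_of_nonneg (by linarith) hτ.le)
  have hρ'0 : ∀ r, r ≤ R' → deriv ρ ((r - R') / τ) = 0 := fun r hr =>
    deriv_ρ_of_nonpos (div_nonpos_of_nonpos_of_nonneg (by linarith) hτ.le)
  have hρ1 : ∀ r, R' + τ ≤ r → ρ ((r - R') / τ) = 1 := fun r hr =>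
    Real.smoothTransition.one_of_one_le ((one_le_div hτ).2 (by linarith))
  have hρ'1 : ∀ r, R' + τ ≤ r → deriv ρ ((r - R') / τ) = 0 := fun r hr =>
    deriv_ρ_of_one_le ((one_le_div hτ).2 (by linarith))
  have hχ1 : ∀ r, η ≤ r → χ (r / η) = 1 := fun r hr => χ_of_one_le ((one_le_div hη).2 hr)
  have hχ'1 : ∀ r, η ≤ r → deriv χ (r / η) = 0 := fun r hr =>
    deriv_χ_of_one_le ((one_le_div hη).2 hr)
  -- `g` on the four regions
  have hk_low : ∀ r, r ≤ R' → k r = f r := fun r hr => by simp only [hk, hρ0 r hr]; ring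
  have hk'_low : ∀ r, r ≤ R' → k' r = deriv f r := fun r hr => by
    simp only [hk', hρ0 r hr, hρ'0 r hr]; ring
  have hg_1 : ∀ r, r ≤ R' → g r = χ (r / η) * f r / c := fun r hr => by rw [hg_eq, hk_low r hr]
  have hg'_1 : ∀ r, r ≤ R' →
      g' r = (deriv χ (r / η) * η⁻¹ * f r + χ (r / η) * deriv f r) / c := fun r hr => by
    simp only [hg', hk_low r hr, hk'_low r hr]
  have hg_2 : ∀ r, η ≤ r → r ≤ R' → g r = c⁻¹ * f r := fun r h1 h2 => by
    rw [hg_1 r h2, hχ1 r h1]; field_simp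
  have hg'_2 : ∀ r, η ≤ r → r ≤ R' → g' r = c⁻¹ * deriv f r := fun r h1 h2 => by
    rw [hg'_1 r h2, hχ1 r h1, hχ'1 r h1]; field_simp; ring
  have hg'_3 : ∀ r, R' ≤ r → g' r = k' r / c := fun r hr => by
    simp only [hg', hχ1 r (hηR.le.trans hr), hχ'1 r (hηR.le.trans hr)]; ring
  have hg_4 : ∀ r, R' + τ ≤ r → g r = 1 := fun r hr => by
    rw [hg_eq, hχ1 r (by linarith)]
    simp only [hk, hρ1 r hr]
    field_simp
    ring
  have hg'_4 : ∀ r, R' + τ ≤ r → g' r = 0 := fun r hr => by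
    rw [hg'_3 r (by linarith)]
    simp only [hk', hρ1 r hr, hρ'1 r hr]
    ring
  -- Part A for the competitor
  have hA : scatteringLength v ≤ ∫⁻ r in Ioi 0, edens v g r := by
    refine scatteringLength_le_lintegral_edens hv (competitor_contDiff hf R' η τ) ?_
      (S := R' + τ) hg_4
    filter_upwards [Iio_mem_nhds (half_pos hη)] with r hr
    have hr' : r < η / 2 := hr
    have : r / η ≤ 1 / 2 := by
      rw [div_le_iff₀ hη]; linarith
    rw [hg_1 r (by linarith), χ_of_le_half this]
    simp
  -- splitting the energy
  set E : ℝ → ℝ≥0∞ := edens v g with hE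
  have hEm : Measurable E := measurable_edens hv (competitor_contDiff hf R' η τ).continuous
  have hsplit : ∫⁻ r in Ioi 0, E r ≤ (∫⁻ r in Ioo 0 η, E r) + (∫⁻ r in Ico η R', E r) +
      (∫⁻ r in Ico R' (R' + τ), E r) + ∫⁻ r in Ici (R' + τ), E r := by
    have hsub : Ioi (0 : ℝ) ⊆ ((Ioo 0 η ∪ Ico η R') ∪ Ico R' (R' + τ)) ∪ Ici (R' + τ) := by
      intro r hr
      simp only [mem_union, mem_Ioo, mem_Ico, mem_Ici, mem_Ioi] at hr ⊢
      rcases lt_or_ge r η with h1 | h1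
      · exact Or.inl (Or.inl (Or.inl ⟨hr, h1⟩))
      rcases lt_or_ge r R' with h2 | h2
      · exact Or.inl (Or.inl (Or.inr ⟨h1, h2⟩))
      rcases lt_or_ge r (R' + τ) with h3 | h3
      · exact Or.inl (Or.inr ⟨h2, h3⟩)
      · exact Or.inr h3
    calc ∫⁻ r in Ioi 0, E r
        ≤ ∫⁻ r in ((Ioo 0 η ∪ Ico η R') ∪ Ico R' (R' + τ)) ∪ Ici (R' + τ), E r :=
          lintegral_mono_set hsub
      _ ≤ _ := by
          refine (lintegral_union_le _ _ _).trans (add_le_add ?_ le_rfl)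
          refine (lintegral_union_le _ _ _).trans (add_le_add ?_ le_rfl)
          exact lintegral_union_le _ _ _
  -- piece 4: beyond `R' + τ` the density vanishes
  have hp4 : ∫⁻ r in Ici (R' + τ), E r = 0 := by
    rw [setLIntegral_congr_fun measurableSet_Ici (fun r hr => ?_)]
    · exact lintegral_zero
    simp only [hE, edens, hderiv, hg'_4 r hr, hvan r (by linarith [mem_Ici.1 hr])]
    simp
  -- piece 3: the blending region
  set M₂ := (M₁ + Mρ * M₁) / |c| with hM₂
  have hmv : ∀ r ∈ Icc R' (R' + 1), |f r - f R'| ≤ M₁ * (r - R') := by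
    intro r hr
    have := norm_image_sub_le_of_norm_deriv_le_segment' (f := f) (f' := deriv f) (a := R')
      (b := R' + 1) (fun x _ => (hfd x).hasDerivWithinAt)
      (fun x hx => (Real.norm_eq_abs _).le.trans (hM₁ x (Ico_subset_Icc_self hx))) r hr
    simpa [Real.norm_eq_abs] using this
  have hp3_pt : ∀ r ∈ Ico R' (R' + τ), E r ≤ ENNReal.ofReal (M₂ ^ 2 * (R' + 1) ^ 2) := by
    intro r hr
    have hr1 : r ∈ Icc R' (R' + 1) := ⟨hr.1, by linarith [hr.2]⟩
    have hk'b : |k' r| ≤ M₁ + Mρ * M₁ := by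
      have e : k' r = deriv f r * (1 - ρ ((r - R') / τ)) +
          deriv ρ ((r - R') / τ) * τ⁻¹ * (c - f r) := by simp only [hk']; ring
      rw [e]
      refine (abs_add_le _ _).trans (add_le_add ?_ ?_)
      · rw [abs_mul]
        have h1 : |1 - ρ ((r - R') / τ)| ≤ 1 := by
          rw [abs_le]
          constructor <;>
            linarith [Real.smoothTransition.nonneg ((r - R') / τ),
              Real.smoothTransition.le_one ((r - R') / τ)]
        calc |deriv f r| * |1 - ρ ((r - R') / τ)| ≤ M₁ * 1 :=
              mul_le_mul (hM₁ r hr1) h1 (abs_nonneg _) hM₁0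
          _ = M₁ := mul_one _
      · rw [abs_mul, abs_mul, abs_inv, abs_of_pos hτ]
        have h2 : |c - f r| ≤ M₁ * τ := by
          rw [abs_sub_comm]
          exact (hmv r hr1).trans (mul_le_mul_of_nonneg_left (by linarith [hr.2]) hM₁0)
        calc |deriv ρ ((r - R') / τ)| * τ⁻¹ * |c - f r| ≤ Mρ * τ⁻¹ * (M₁ * τ) := by
              gcongr
              exact hMρ _
          _ = Mρ * M₁ := by field_simp
    have hg'b : (g' r) ^ 2 ≤ M₂ ^ 2 := by
      rw [hg'_3 r hr.1, hM₂, div_pow, div_pow, sq_abs]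
      gcongr (?_) / _
      exact (sq_abs _).symm.trans_le (pow_le_pow_left₀ (abs_nonneg _) hk'b 2)
    have hr2 : r ^ 2 ≤ (R' + 1) ^ 2 :=
      pow_le_pow_left₀ (hR'pos.le.trans hr.1) (by linarith [hr.2]) 2
    calc E r = ENNReal.ofReal ((g' r) ^ 2) * ENNReal.ofReal (r ^ 2) := by
          simp only [hE, edens, hderiv, hvan r (hR'.trans_le hr.1)]
          simp
      _ ≤ ENNReal.ofReal (M₂ ^ 2) * ENNReal.ofReal ((R' + 1) ^ 2) := by
          gcongr
      _ = ENNReal.ofReal (M₂ ^ 2 * (R' + 1) ^ 2) := (ENNReal.ofReal_mul (by positivity)).symm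
  have hp3 : ∫⁻ r in Ico R' (R' + τ), E r ≤ ENNReal.ofReal (M₂ ^ 2 * (R' + 1) ^ 2 * τ) := by
    calc ∫⁻ r in Ico R' (R' + τ), E r
        ≤ ∫⁻ _ in Ico R' (R' + τ), ENNReal.ofReal (M₂ ^ 2 * (R' + 1) ^ 2) :=
          setLIntegral_mono measurable_const hp3_pt
      _ = ENNReal.ofReal (M₂ ^ 2 * (R' + 1) ^ 2 * τ) := by
          rw [setLIntegral_const, Real.volume_Ico, add_sub_cancel_left,
            ← ENNReal.ofReal_mul (by positivity)]
  -- piece 2: the competitor is `f/c`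
  have hp2 : ∫⁻ r in Ico η R', E r ≤ ENNReal.ofReal (c⁻¹ ^ 2) * ∫⁻ r in Ioo 0 R', edens v f r := by
    have hpt : ∀ r ∈ Ico η R', E r = ENNReal.ofReal (c⁻¹ ^ 2) * edens v f r := by
      intro r hr
      simp only [hE, edens, hderiv, hg_2 r hr.1 hr.2.le, hg'_2 r hr.1 hr.2.le, mul_pow]
      rw [ENNReal.ofReal_mul (by positivity), ENNReal.ofReal_mul (by positivity)]
      ring
    rw [setLIntegral_congr_fun measurableSet_Ico hpt, lintegral_const_mul _
      (measurable_edens hv hf.continuous)]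
    exact mul_le_mul' le_rfl (lintegral_mono_set (Ico_subset_Ioo_left hη))
  -- piece 1: the cutoff region
  set X := Mχ * Mf / (η * c) with hX
  have hp1_pt : ∀ r ∈ Ioo 0 η, E r ≤ ENNReal.ofReal (2 * X ^ 2) * ENNReal.ofReal (r ^ 2) +
      ENNReal.ofReal (2 * c⁻¹ ^ 2) * edens v f r := by
    intro r hr
    have hrR : r ≤ R' := by linarith [hr.2]
    have hfr : |f r| ≤ Mf := hMf r ⟨hr.1.le, hrR⟩
    have h1 : (g' r) ^ 2 ≤ 2 * X ^ 2 + 2 * c⁻¹ ^ 2 * (deriv f r) ^ 2 := by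
      rw [hg'_1 r hrR]
      have hA1 : (deriv χ (r / η) * η⁻¹ * f r / c) ^ 2 ≤ X ^ 2 := by
        rw [hX, div_pow, div_pow, mul_pow, mul_pow, mul_pow, mul_pow]
        have e1 : (deriv χ (r / η)) ^ 2 ≤ Mχ ^ 2 :=
          (sq_abs _).symm.trans_le (pow_le_pow_left₀ (abs_nonneg _) (hMχ _) 2)
        have e2 : (f r) ^ 2 ≤ Mf ^ 2 :=
          (sq_abs _).symm.trans_le (pow_le_pow_left₀ (abs_nonneg _) hfr 2)
        have hη2 : η⁻¹ ^ 2 = (η ^ 2)⁻¹ := by rw [inv_pow]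
        rw [hη2, show Mχ ^ 2 * Mf ^ 2 / (η ^ 2 * c ^ 2) = Mχ ^ 2 * (η ^ 2)⁻¹ * Mf ^ 2 / c ^ 2 by
          field_simp]
        gcongr
      have hB1 : (χ (r / η) * deriv f r / c) ^ 2 ≤ c⁻¹ ^ 2 * (deriv f r) ^ 2 := by
        rw [div_pow, mul_pow]
        have e3 : (χ (r / η)) ^ 2 ≤ 1 := by
          have := abs_χ_le_one (r / η)
          rw [← sq_abs]; nlinarith [abs_nonneg (χ (r / η))]
        rw [show c⁻¹ ^ 2 * deriv f r ^ 2 = 1 * deriv f r ^ 2 / c ^ 2 by field_simp]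
        gcongr
      calc ((deriv χ (r / η) * η⁻¹ * f r + χ (r / η) * deriv f r) / c) ^ 2
          = (deriv χ (r / η) * η⁻¹ * f r / c + χ (r / η) * deriv f r / c) ^ 2 := by ring
        _ ≤ 2 * ((deriv χ (r / η) * η⁻¹ * f r / c) ^ 2 + (χ (r / η) * deriv f r / c) ^ 2) :=
            add_sq_le
        _ ≤ 2 * (X ^ 2 + c⁻¹ ^ 2 * (deriv f r) ^ 2) := by gcongr
        _ = _ := by ring
    have h2 : (g r) ^ 2 ≤ 2 * c⁻¹ ^ 2 * (f r) ^ 2 := by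
      rw [hg_1 r hrR, div_pow, mul_pow]
      have e3 : (χ (r / η)) ^ 2 ≤ 1 := by
        have := abs_χ_le_one (r / η)
        rw [← sq_abs]; nlinarith [abs_nonneg (χ (r / η))]
      have : χ (r / η) ^ 2 * f r ^ 2 / c ^ 2 ≤ 1 * f r ^ 2 / c ^ 2 := by gcongr
      rw [show 2 * c⁻¹ ^ 2 * f r ^ 2 = 2 * (1 * f r ^ 2 / c ^ 2) by field_simp]
      linarith [div_nonneg (mul_nonneg zero_le_one (sq_nonneg (f r))) (sq_nonneg c)]
    calc E r = (ENNReal.ofReal ((g' r) ^ 2) + 2⁻¹ * v r * ENNReal.ofReal ((g r) ^ 2)) *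
          ENNReal.ofReal (r ^ 2) := by simp only [hE, edens, hderiv]
      _ ≤ (ENNReal.ofReal (2 * X ^ 2 + 2 * c⁻¹ ^ 2 * (deriv f r) ^ 2) +
            2⁻¹ * v r * ENNReal.ofReal (2 * c⁻¹ ^ 2 * (f r) ^ 2)) * ENNReal.ofReal (r ^ 2) := by
          gcongr
      _ = _ := by
          rw [ENNReal.ofReal_add (by positivity) (by positivity),
            ENNReal.ofReal_mul (by positivity : (0 : ℝ) ≤ 2 * c⁻¹ ^ 2),
            ENNReal.ofReal_mul (by positivity : (0 : ℝ) ≤ 2 * c⁻¹ ^ 2)]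
          simp only [edens]
          ring
  have hp1 : ∫⁻ r in Ioo 0 η, E r ≤ ENNReal.ofReal (2 * (Mχ * Mf / c) ^ 2 * η) +
      ENNReal.ofReal (2 * c⁻¹ ^ 2) * ∫⁻ r in Ioo 0 η, edens v f r := by
    calc ∫⁻ r in Ioo 0 η, E r
        ≤ ∫⁻ r in Ioo 0 η, (ENNReal.ofReal (2 * X ^ 2) * ENNReal.ofReal (r ^ 2) +
            ENNReal.ofReal (2 * c⁻¹ ^ 2) * edens v f r) :=
          setLIntegral_mono' measurableSet_Ioo hp1_pt
      _ = (∫⁻ r in Ioo 0 η, ENNReal.ofReal (2 * X ^ 2) * ENNReal.ofReal (r ^ 2)) +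
            ENNReal.ofReal (2 * c⁻¹ ^ 2) * ∫⁻ r in Ioo 0 η, edens v f r := by
          rw [lintegral_add_left (by fun_prop), lintegral_const_mul _
            (measurable_edens hv hf.continuous)]
      _ ≤ ENNReal.ofReal (2 * X ^ 2) * ENNReal.ofReal (η ^ 2) * volume (Ioo (0 : ℝ) η) +
            ENNReal.ofReal (2 * c⁻¹ ^ 2) * ∫⁻ r in Ioo 0 η, edens v f r := by
          gcongr
          calc ∫⁻ r in Ioo 0 η, ENNReal.ofReal (2 * X ^ 2) * ENNReal.ofReal (r ^ 2)
              ≤ ∫⁻ _ in Ioo 0 η, ENNReal.ofReal (2 * X ^ 2) * ENNReal.ofReal (η ^ 2) :=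
                setLIntegral_mono measurable_const fun r hr => by
                  gcongr
                  exacts [hr.1.le, hr.2.le]
            _ = _ := setLIntegral_const _ _
      _ = _ := by
          rw [Real.volume_Ioo, sub_zero, ← ENNReal.ofReal_mul (by positivity),
            ← ENNReal.ofReal_mul (by positivity), hX]
          congr 2
          field_simp
  -- conclusion
  calc scatteringLength v ≤ ∫⁻ r in Ioi 0, E r := hA
    _ ≤ _ := hsplit
    _ ≤ (ENNReal.ofReal (2 * (Mχ * Mf / c) ^ 2 * η) +
          ENNReal.ofReal (2 * c⁻¹ ^ 2) * ∫⁻ r in Ioo 0 η, edens v f r) +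
          ENNReal.ofReal (c⁻¹ ^ 2) * (∫⁻ r in Ioo 0 R', edens v f r) +
          ENNReal.ofReal (M₂ ^ 2 * (R' + 1) ^ 2 * τ) + 0 := by
        gcongr
        exact hp4.le
    _ = _ := by rw [add_zero]

end Competitor

/-! ### The core bound along a ray -/

section Core

variable {v : ℝ → ℝ≥0∞} {R₀ R' : ℝ}

/-- `ofReal`-valued functions of a real variable that are continuous at `0` with value `0` tend
to `0` along `𝓝[>] 0`. [folklore] -/
theorem tendsto_ofReal_nhdsGT_zero {F : ℝ → ℝ} (hF : Continuous F) (h0 : F 0 = 0) :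
    Tendsto (fun t => ENNReal.ofReal (F t)) (𝓝[>] (0 : ℝ)) (𝓝 0) := by
  have h1 : Tendsto F (𝓝[>] (0 : ℝ)) (𝓝 0) := by
    simpa [h0] using (hF.tendsto 0).mono_left nhdsWithin_le_nhds
  have h2 := (ENNReal.continuous_ofReal.tendsto 0).comp h1
  rw [ENNReal.ofReal_zero] at h2
  exact h2

/-- **The core bound (real profiles).** For `f ∈ C¹(ℝ; ℝ)` and `R' > R₀`,
`a f(R')² ≤ ∫_0^{R'} (f'(r)² + ½ v(r) f(r)²) r² dr`: the energy of the competitor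
(`scatteringLength_le_competitor`) is at most `f(R')⁻² ∫_0^{R'} edens(f)` plus errors that
vanish as `η, τ → 0`. This is (2.38) of the source for the `δ`-shell potential at radius `R'`
(there derived from the scattering equation; here from the variational principle).
[cite: LSSY2005, Lemma 2.5, (2.38)–(2.39)] -/
theorem core_real (hv : Measurable v) (hR₀ : 0 ≤ R₀) (hvan : ∀ r, R₀ < r → v r = 0)
    {f : ℝ → ℝ} (hf : ContDiff ℝ 1 f) (hR' : R₀ < R') :
    scatteringLength v * ENNReal.ofReal (f R' ^ 2) ≤ ∫⁻ r in Ioo 0 R', edens v f r := by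
  set A := ∫⁻ r in Ioo 0 R', edens v f r with hA_def
  have hR'pos : 0 < R' := hR₀.trans_lt hR'
  by_cases hc : f R' = 0
  · simp [hc]
  by_cases hAtop : A = ⊤
  · rw [hAtop]; exact le_top
  set c := f R' with hc_def
  -- a priori bounds
  obtain ⟨Mf, hMf⟩ := isCompact_Icc.exists_bound_of_continuousOn
    (hf.continuous.continuousOn (s := Icc (0 : ℝ) R'))
  obtain ⟨M₁, hM₁⟩ := isCompact_Icc.exists_bound_of_continuousOn
    (hf.continuous_deriv_one.continuousOn (s := Icc R' (R' + 1)))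
  obtain ⟨Mχ, hMχ0, hMχ⟩ := exists_bound_deriv_χ
  obtain ⟨Mρ, hMρ0, hMρ⟩ := exists_bound_deriv_ρ
  replace hMf : ∀ r ∈ Icc 0 R', |f r| ≤ Mf := fun r hr =>
    (Real.norm_eq_abs _).symm.le.trans (hMf r hr)
  replace hM₁ : ∀ r ∈ Icc R' (R' + 1), |deriv f r| ≤ M₁ := fun r hr =>
    (Real.norm_eq_abs _).symm.le.trans (hM₁ r hr)
  set M₂ := (M₁ + Mρ * M₁) / |c| with hM₂
  -- the main estimate: `a ≤ c⁻² A`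
  have key : scatteringLength v ≤ ENNReal.ofReal (c⁻¹ ^ 2) * A := by
    refine ENNReal.le_of_forall_pos_le_add fun ε hε _ => ?_
    have hε2 : (0 : ℝ≥0∞) < (ε : ℝ≥0∞) / 2 := ENNReal.half_pos (ENNReal.coe_ne_zero.2 hε.ne')
    -- the error `E₁(η)` tends to zero
    set μR := (volume : Measure ℝ).restrict (Ioo 0 R') with hμR
    have hT1 : Tendsto (fun η : ℝ => ENNReal.ofReal (2 * (Mχ * Mf / c) ^ 2 * η) +
        ENNReal.ofReal (2 * c⁻¹ ^ 2) * ∫⁻ r in Ioo 0 η, edens v f r ∂μR) (𝓝[>] 0) (𝓝 0) := by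
      have h1 : Tendsto (fun η : ℝ => ENNReal.ofReal (2 * (Mχ * Mf / c) ^ 2 * η)) (𝓝[>] 0)
          (𝓝 0) := tendsto_ofReal_nhdsGT_zero (by fun_prop) (by simp)
      have h2 : Tendsto (fun η : ℝ => ∫⁻ r in Ioo 0 η, edens v f r ∂μR) (𝓝[>] 0) (𝓝 0) := by
        refine tendsto_setLIntegral_zero (μ := μR) (by simpa [hμR] using hAtop) ?_
        have hle : ∀ η : ℝ, (μR ∘ fun η => Ioo 0 η) η ≤ ENNReal.ofReal η := fun η => by
          simp only [Function.comp_apply, hμR, Measure.restrict_apply measurableSet_Ioo]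
          calc volume (Ioo 0 η ∩ Ioo 0 R') ≤ volume (Ioo (0 : ℝ) η) :=
                measure_mono inter_subset_left
            _ = ENNReal.ofReal η := by rw [Real.volume_Ioo, sub_zero]
        exact tendsto_of_tendsto_of_tendsto_of_le_of_le tendsto_const_nhds
          (tendsto_ofReal_nhdsGT_zero continuous_id rfl) (fun η => zero_le) hle
      have h3 := h1.add (ENNReal.Tendsto.const_mul h2 (Or.inr ENNReal.ofReal_ne_top)
        (a := ENNReal.ofReal (2 * c⁻¹ ^ 2)))
      rw [mul_zero, add_zero] at h3
      exact h3
    obtain ⟨η, ⟨⟨hη1, hηR⟩, hη0⟩⟩ :=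
      (((hT1.eventually (gt_mem_nhds hε2)).and
        (mem_nhdsWithin_of_mem_nhds (Iio_mem_nhds hR'pos))).and self_mem_nhdsWithin).exists
    have hη0 : 0 < η := hη0
    have hηR : η < R' := hηR
    have hrestr : ∫⁻ r in Ioo 0 η, edens v f r ∂μR = ∫⁻ r in Ioo 0 η, edens v f r := by
      rw [hμR, Measure.restrict_restrict measurableSet_Ioo,
        inter_eq_left.2 (Ioo_subset_Ioo_right hηR.le)]
    rw [hrestr] at hη1
    -- the error `E₂(τ)` tends to zero
    have hT2 : Tendsto (fun τ : ℝ => ENNReal.ofReal (M₂ ^ 2 * (R' + 1) ^ 2 * τ)) (𝓝[>] 0)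
        (𝓝 0) := tendsto_ofReal_nhdsGT_zero (by fun_prop) (by simp)
    obtain ⟨τ, ⟨⟨hτ1, hτone⟩, hτ0⟩⟩ :=
      (((hT2.eventually (gt_mem_nhds hε2)).and
        (mem_nhdsWithin_of_mem_nhds (Iio_mem_nhds one_pos))).and self_mem_nhdsWithin).exists
    have hτ0 : 0 < τ := hτ0
    have hτone : τ < 1 := hτone
    -- combine
    have hcomp := scatteringLength_le_competitor hv hR₀ hvan hf hR' hc hMf hM₁ hMχ hMρ hMρ0
      hη0 hηR hτ0 hτone.le
    calc scatteringLength v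
        ≤ (ENNReal.ofReal (2 * (Mχ * Mf / c) ^ 2 * η) +
            ENNReal.ofReal (2 * c⁻¹ ^ 2) * ∫⁻ r in Ioo 0 η, edens v f r) +
            ENNReal.ofReal (c⁻¹ ^ 2) * A + ENNReal.ofReal (M₂ ^ 2 * (R' + 1) ^ 2 * τ) := hcomp
      _ ≤ (ε : ℝ≥0∞) / 2 + ENNReal.ofReal (c⁻¹ ^ 2) * A + (ε : ℝ≥0∞) / 2 := by
          gcongr
      _ = ENNReal.ofReal (c⁻¹ ^ 2) * A + ε := by
          rw [add_comm ((ε : ℝ≥0∞) / 2), add_assoc, ENNReal.add_halves]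
  -- multiply by `c²`
  calc scatteringLength v * ENNReal.ofReal (c ^ 2)
      ≤ ENNReal.ofReal (c⁻¹ ^ 2) * A * ENNReal.ofReal (c ^ 2) := mul_le_mul' key le_rfl
    _ = A := by
        rw [mul_comm, ← mul_assoc, ← ENNReal.ofReal_mul (sq_nonneg _),
          show c ^ 2 * c⁻¹ ^ 2 = 1 by field_simp, ENNReal.ofReal_one, one_mul]

end Core

/-! ### Complex profiles and the ray bound -/

section Ray

variable {v : ℝ → ℝ≥0∞} {R₀ R : ℝ}

variable (v) in
/-- The radial energy density `(|f'(r)|² + ½ v(r) |f(r)|²) r²` of a complex profile `f`.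
[cite: LSSY2005, (2.38)] -/
def edensC (f : ℝ → ℂ) (r : ℝ) : ℝ≥0∞ :=
  (((‖deriv f r‖₊ : ℝ≥0∞)) ^ 2 + 2⁻¹ * v r * ((‖f r‖₊ : ℝ≥0∞)) ^ 2) * ENNReal.ofReal (r ^ 2)

/-- The complex energy density is measurable. [folklore] -/
theorem measurable_edensC (hv : Measurable v) {f : ℝ → ℂ} (hf : Continuous f) :
    Measurable (edensC v f) := by
  unfold edensC
  have h1 : Measurable (deriv f) := measurable_deriv f
  have h2 : Measurable f := hf.measurable
  fun_prop

/-- `‖z‖² = (re z)² + (im z)²` in `ℝ≥0∞`. [folklore] -/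
theorem nnnorm_sq_complex (z : ℂ) :
    ((‖z‖₊ : ℝ≥0∞)) ^ 2 = ENNReal.ofReal (z.re ^ 2) + ENNReal.ofReal (z.im ^ 2) := by
  rw [nnnorm_sq_eq_ofReal, ← ENNReal.ofReal_add (sq_nonneg _) (sq_nonneg _), Complex.sq_norm,
    Complex.normSq_apply]
  congr 1; ring

/-- The complex energy density splits into those of the real and imaginary parts. [folklore] -/
theorem edensC_eq_add {f : ℝ → ℂ} (hf : ContDiff ℝ 1 f) (r : ℝ) :
    edensC v f r = edens v (fun s => (f s).re) r + edens v (fun s => (f s).im) r := by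
  have hfd : HasDerivAt f (deriv f r) r := (hf.differentiable one_ne_zero r).hasDerivAt
  have h1 : deriv (fun s => (f s).re) r = (deriv f r).re :=
    (Complex.reCLM.hasFDerivAt.comp_hasDerivAt r hfd).deriv
  have h2 : deriv (fun s => (f s).im) r = (deriv f r).im :=
    (Complex.imCLM.hasFDerivAt.comp_hasDerivAt r hfd).deriv
  simp only [edensC, edens, h1, h2, nnnorm_sq_complex]
  ring

/-- **The core bound (complex profiles)**: `a |f(R')|² ≤ ∫_0^{R'} (|f'|² + ½ v |f|²) r² dr` for
`f ∈ C¹(ℝ; ℂ)` and `R' > R₀` (real and imaginary parts separately).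
[cite: LSSY2005, Lemma 2.5, (2.38)] -/
theorem core (hv : Measurable v) (hR₀ : 0 ≤ R₀) (hvan : ∀ r, R₀ < r → v r = 0)
    {f : ℝ → ℂ} (hf : ContDiff ℝ 1 f) {R' : ℝ} (hR' : R₀ < R') :
    scatteringLength v * ((‖f R'‖₊ : ℝ≥0∞)) ^ 2 ≤ ∫⁻ r in Ioo 0 R', edensC v f r := by
  have hre : ContDiff ℝ 1 fun s => (f s).re := Complex.reCLM.contDiff.comp hf
  have him : ContDiff ℝ 1 fun s => (f s).im := Complex.imCLM.contDiff.comp hf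
  have h1 := core_real hv hR₀ hvan hre hR'
  have h2 := core_real hv hR₀ hvan him hR'
  simp_rw [edensC_eq_add hf]
  rw [lintegral_add_left (measurable_edens hv hre.continuous), nnnorm_sq_complex, mul_add]
  exact add_le_add h1 h2

/-- `∫_0^∞ U_R(r) r² dr = 1`. [cite: LSSY2005, Lemma 2.5 (`∫ U(r) r² dr ≤ 1`)] -/
theorem lintegral_dysonPotential_mul_sq (hR₀ : 0 ≤ R₀) (hR : R₀ < R) :
    ∫⁻ r in Ioi 0, dysonPotential R₀ R r * ENNReal.ofReal (r ^ 2) = 1 := by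
  have hΔ : 0 < R ^ 3 - R₀ ^ 3 := sub_pos.2 (pow_lt_pow_left₀ hR hR₀ three_ne_zero)
  have h1 : ∀ r, dysonPotential R₀ R r * ENNReal.ofReal (r ^ 2) =
      (Ioo R₀ R).indicator (fun r => ENNReal.ofReal (3 / (R ^ 3 - R₀ ^ 3)) *
        ENNReal.ofReal (r ^ 2)) r := fun r =>
    (Set.indicator_mul_left (Ioo R₀ R) (fun _ => ENNReal.ofReal (3 / (R ^ 3 - R₀ ^ 3)))
      (fun r => ENNReal.ofReal (r ^ 2)) (i := r)).symm
  have hsub : Ioo R₀ R ⊆ Ioi 0 := fun r hr => hR₀.trans_lt hr.1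
  simp_rw [h1]
  rw [lintegral_indicator measurableSet_Ioo, Measure.restrict_restrict measurableSet_Ioo,
    inter_eq_left.2 hsub, lintegral_const_mul _ (by fun_prop)]
  have hint : ∫⁻ r in Ioo R₀ R, ENNReal.ofReal (r ^ 2) = ENNReal.ofReal ((R ^ 3 - R₀ ^ 3) / 3) := by
    have hi : IntegrableOn (fun r : ℝ => r ^ 2) (Ioo R₀ R) :=
      ((continuous_pow 2).integrableOn_Icc).mono_set Ioo_subset_Icc_self
    rw [← ofReal_integral_eq_lintegral_ofReal hi (ae_of_all _ fun r => sq_nonneg r),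
      ← integral_Ioc_eq_integral_Ioo, ← intervalIntegral.integral_of_le hR.le, integral_pow]
    norm_num
  rw [hint, ← ENNReal.ofReal_mul (by positivity), ← ENNReal.ofReal_one]
  congr 1
  field_simp

/-- **The ray bound.** Let `S ⊆ (0,∞)` be measurable and star-shaped from `0`
(`r ∈ S ⇒ (0,r) ⊆ S`), and `f ∈ C¹(ℝ; ℂ)`. Then
`a ∫_S U_R |f|² r² dr ≤ ∫_S (|f'|² + ½ v|f|²) r² dr`: for `r ∈ S` with `U_R(r) ≠ 0` one has
`r > R₀`, so the core bound gives `a|f(r)|² ≤ ∫_0^r edens ≤ ∫_S edens`; multiply by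
`U_R(r) r²` and integrate, using `∫ U_R r² ≤ 1` ("every `U` is a superposition of
`δ`-functions"). [cite: LSSY2005, Lemma 2.5, proof (superposition of (2.37)–(2.38))] -/
theorem ray_bound (hv : Measurable v) (hR₀ : 0 ≤ R₀) (hvan : ∀ r, R₀ < r → v r = 0)
    (hR : R₀ < R) {S : Set ℝ} (hSm : MeasurableSet S) (hS0 : S ⊆ Ioi 0)
    (hdown : ∀ r ∈ S, Ioo 0 r ⊆ S) {f : ℝ → ℂ} (hf : ContDiff ℝ 1 f) :
    scatteringLength v *
        ∫⁻ r in S, dysonPotential R₀ R r * ((‖f r‖₊ : ℝ≥0∞)) ^ 2 * ENNReal.ofReal (r ^ 2) ≤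
      ∫⁻ r in S, edensC v f r := by
  set B := ∫⁻ r in S, edensC v f r with hB
  set a := scatteringLength v with ha
  have key : ∀ r ∈ S, a * (dysonPotential R₀ R r * ((‖f r‖₊ : ℝ≥0∞)) ^ 2 * ENNReal.ofReal (r ^ 2)) ≤
      dysonPotential R₀ R r * ENNReal.ofReal (r ^ 2) * B := by
    intro r hrS
    by_cases hr : r ∈ Ioo R₀ R
    · have h1 : a * ((‖f r‖₊ : ℝ≥0∞)) ^ 2 ≤ B :=
        (core hv hR₀ hvan hf hr.1).trans (lintegral_mono_set (hdown r hrS))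
      calc a * (dysonPotential R₀ R r * ((‖f r‖₊ : ℝ≥0∞)) ^ 2 * ENNReal.ofReal (r ^ 2))
          = dysonPotential R₀ R r * ENNReal.ofReal (r ^ 2) * (a * ((‖f r‖₊ : ℝ≥0∞)) ^ 2) := by ring
        _ ≤ dysonPotential R₀ R r * ENNReal.ofReal (r ^ 2) * B := mul_le_mul' le_rfl h1
    · simp [dysonPotential, Set.indicator_of_notMem hr]
  have hUm : Measurable fun r => dysonPotential R₀ R r * ENNReal.ofReal (r ^ 2) :=
    (measurable_dysonPotential R₀ R).mul (by fun_prop)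
  have hm : Measurable fun r =>
      dysonPotential R₀ R r * ((‖f r‖₊ : ℝ≥0∞)) ^ 2 * ENNReal.ofReal (r ^ 2) := by
    have := hf.continuous.measurable
    exact ((measurable_dysonPotential R₀ R).mul (by fun_prop)).mul (by fun_prop)
  calc a * ∫⁻ r in S, dysonPotential R₀ R r * ((‖f r‖₊ : ℝ≥0∞)) ^ 2 * ENNReal.ofReal (r ^ 2)
      = ∫⁻ r in S, a * (dysonPotential R₀ R r * ((‖f r‖₊ : ℝ≥0∞)) ^ 2 * ENNReal.ofReal (r ^ 2)) :=
        (lintegral_const_mul _ hm).symm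
    _ ≤ ∫⁻ r in S, dysonPotential R₀ R r * ENNReal.ofReal (r ^ 2) * B := setLIntegral_mono' hSm key
    _ = (∫⁻ r in S, dysonPotential R₀ R r * ENNReal.ofReal (r ^ 2)) * B := lintegral_mul_const _ hUm
    _ ≤ (∫⁻ r in Ioi 0, dysonPotential R₀ R r * ENNReal.ofReal (r ^ 2)) * B :=
        mul_le_mul' (lintegral_mono_set hS0) le_rfl
    _ = B := by rw [lintegral_dysonPotential_mul_sq hR₀ hR, one_mul]

end Ray

/-! ### Lemma 2.5: star-shaped regions in `ℝ³` -/

section Lemma25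

variable {v : ℝ → ℝ≥0∞} {R₀ R : ℝ}

/-- `gradSqC ψ` (`|∇ψ|²` of `PeriodicBoseGasLocalization.lean`; the pending librarian refactor
merging it with `gradSq` of `PeriodicBoseGas.lean` applies here too) is measurable for `ψ ∈ C¹`.
[folklore] -/
theorem measurable_gradSqC {ψ : Space → ℂ} (hψ : ContDiff ℝ 1 ψ) : Measurable (gradSqC ψ) := by
  unfold gradSqC
  refine Finset.measurable_sum _ fun k _ => ?_
  have : Continuous fun x => fderiv ℝ ψ x (EuclideanSpace.single k (1 : ℝ)) :=
    (hψ.continuous_fderiv one_ne_zero).clm_apply continuous_const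
  fun_prop

/-- **The radial derivative is at most the full gradient**: for a unit vector `ω`,
`|Dψ(x) ω|² ≤ ∑ₖ |∂ₖψ(x)|²` (Cauchy–Schwarz in the coordinates of `ω`).
[cite: LSSY2005, Lemma 2.5, proof (radial kinetic energy)] -/
theorem nnnorm_fderiv_apply_sq_le_gradSqC (ψ : Space → ℂ) (x ω : Space) (hω : ‖ω‖ = 1) :
    ((‖fderiv ℝ ψ x ω‖₊ : ℝ≥0∞)) ^ 2 ≤ gradSqC ψ x := by
  set T := fderiv ℝ ψ x with hT
  have hrepr : ω = ∑ k : Fin 3, ω k • EuclideanSpace.single k (1 : ℝ) := by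
    conv_lhs => rw [← (EuclideanSpace.basisFun (Fin 3) ℝ).sum_repr ω]
    simp [EuclideanSpace.basisFun_apply]
  have h1 : ‖T ω‖ ≤ ∑ k : Fin 3, |ω k| * ‖T (EuclideanSpace.single k 1)‖ := by
    conv_lhs => rw [hrepr]
    rw [map_sum]
    refine (norm_sum_le _ _).trans (le_of_eq (Finset.sum_congr rfl fun k _ => ?_))
    rw [map_smul, norm_smul, Real.norm_eq_abs]
  have h2 : (∑ k : Fin 3, |ω k| * ‖T (EuclideanSpace.single k 1)‖) ^ 2 ≤
      (∑ k : Fin 3, |ω k| ^ 2) * ∑ k : Fin 3, ‖T (EuclideanSpace.single k 1)‖ ^ 2 :=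
    Finset.sum_mul_sq_le_sq_mul_sq _ _ _
  have h3 : ∑ k : Fin 3, |ω k| ^ 2 = 1 := by
    have := EuclideanSpace.norm_eq ω
    rw [hω] at this
    have h := congrArg (· ^ 2) this
    simp only [one_pow, Real.norm_eq_abs] at h
    rw [Real.sq_sqrt (Finset.sum_nonneg fun k _ => by positivity)] at h
    exact h.symm
  rw [h3, one_mul] at h2
  unfold gradSqC
  simp only [nnnorm_sq_eq_ofReal]
  rw [← ENNReal.ofReal_sum_of_nonneg (fun k _ => by positivity)]
  refine ENNReal.ofReal_le_ofReal ((pow_le_pow_left₀ (norm_nonneg _) h1 2).trans h2)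

/-- **Lemma 2.5 (regions star-shaped with respect to the origin).** Let `v ≥ 0` be measurable
with `v(r) = 0` for `r > R₀ ≥ 0`, `R > R₀`, `C ⊆ ℝ³` measurable and star-shaped with respect
to `0`, and `ψ ∈ C¹(ℝ³; ℂ)`. Then
`a ∫_C U_R(|x|) |ψ|² dx ≤ ∫_C (|∇ψ|² + ½ v(|x|) |ψ|²) dx`: in polar coordinates each ray
meets `C` in a star-shaped set of radii, on which the ray bound applies, and the radial
derivative is bounded by the gradient. [cite: LSSY2005, Lemma 2.5 (2.36)] -/
theorem lemma25_zero (hv : Measurable v) (hR₀ : 0 ≤ R₀) (hvan : ∀ r, R₀ < r → v r = 0)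
    (hR : R₀ < R) {C : Set Space} (hC : MeasurableSet C)
    (hstar : ∀ x ∈ C, ∀ t ∈ Ioo (0 : ℝ) 1, t • x ∈ C) {ψ : Space → ℂ} (hψ : ContDiff ℝ 1 ψ) :
    scatteringLength v * ∫⁻ x in C, dysonPotential R₀ R ‖x‖ * ((‖ψ x‖₊ : ℝ≥0∞)) ^ 2 ≤
      ∫⁻ x in C, gradSqC ψ x + 2⁻¹ * v ‖x‖ * ((‖ψ x‖₊ : ℝ≥0∞)) ^ 2 := by
  set a := scatteringLength v with ha
  set F₁ : Space → ℝ≥0∞ := fun x => dysonPotential R₀ R ‖x‖ * ((‖ψ x‖₊ : ℝ≥0∞)) ^ 2 with hF₁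
  set F₂ : Space → ℝ≥0∞ := fun x => gradSqC ψ x + 2⁻¹ * v ‖x‖ * ((‖ψ x‖₊ : ℝ≥0∞)) ^ 2 with hF₂
  have hψm : Measurable ψ := hψ.continuous.measurable
  have hF₁m : Measurable F₁ :=
    ((measurable_dysonPotential R₀ R).comp measurable_norm).mul (by fun_prop)
  have hF₂m : Measurable F₂ :=
    (measurable_gradSqC hψ).add ((measurable_const.mul (hv.comp measurable_norm)).mul (by fun_prop))
  set G₁ := C.indicator F₁ with hG₁
  set G₂ := C.indicator F₂ with hG₂
  have hG₁m : Measurable G₁ := hF₁m.indicator hC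
  have hG₂m : Measurable G₂ := hF₂m.indicator hC
  -- the ray inequality, for every direction
  have hray : ∀ ω : sphere (0 : Space) 1,
      a * ∫⁻ r in Ioi (0 : ℝ), G₁ (r • (ω : Space)) * ENNReal.ofReal (r ^ 2) ≤
        ∫⁻ r in Ioi (0 : ℝ), G₂ (r • (ω : Space)) * ENNReal.ofReal (r ^ 2) := by
    intro ω
    have hω : ‖(ω : Space)‖ = 1 := mem_sphere_zero_iff_norm.1 ω.2
    set S : Set ℝ := Ioi 0 ∩ (fun r : ℝ => r • (ω : Space)) ⁻¹' C with hS
    have hSm : MeasurableSet S :=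
      measurableSet_Ioi.inter (hC.preimage (continuous_id.smul continuous_const).measurable)
    have hS0 : S ⊆ Ioi 0 := inter_subset_left
    have hdown : ∀ r ∈ S, Ioo 0 r ⊆ S := by
      intro r hr r' hr'
      refine ⟨hr'.1, ?_⟩
      have ht : r' / r ∈ Ioo (0 : ℝ) 1 := ⟨div_pos hr'.1 hr.1, (div_lt_one hr.1).2 hr'.2⟩
      have := hstar _ hr.2 (r' / r) ht
      simp only [mem_preimage, smul_smul] at this ⊢
      rwa [div_mul_cancel₀ _ hr.1.ne'] at this
    set f : ℝ → ℂ := fun r => ψ (r • (ω : Space)) with hf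
    have hfC : ContDiff ℝ 1 f := hψ.comp (contDiff_id.smul contDiff_const)
    have hfd : ∀ r, deriv f r = fderiv ℝ ψ (r • (ω : Space)) ω := by
      intro r
      have h1 : HasDerivAt (fun r : ℝ => r • (ω : Space)) (ω : Space) r := by
        simpa using (hasDerivAt_id r).smul_const (ω : Space)
      exact (((hψ.differentiable one_ne_zero) _).hasFDerivAt.comp_hasDerivAt r h1).deriv
    -- rewrite the two sides as integrals over `S`
    have hnorm : ∀ r ∈ S, ‖r • (ω : Space)‖ = r := fun r hr => by
      rw [norm_smul, Real.norm_of_nonneg (le_of_lt hr.1), hω, mul_one]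
    have hind : ∀ (F : Space → ℝ≥0∞) (r : ℝ), C.indicator F (r • (ω : Space)) =
        ((fun r : ℝ => r • (ω : Space)) ⁻¹' C).indicator (fun r => F (r • (ω : Space))) r :=
      fun F r => (Set.indicator_comp_right (fun r : ℝ => r • (ω : Space)) (g := F)).symm
    have hset : ∀ (F : Space → ℝ≥0∞), Measurable F →
        ∫⁻ r in Ioi (0 : ℝ), C.indicator F (r • (ω : Space)) * ENNReal.ofReal (r ^ 2) =
          ∫⁻ r in S, F (r • (ω : Space)) * ENNReal.ofReal (r ^ 2) := by
      intro F hFm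
      have hpre : MeasurableSet ((fun r : ℝ => r • (ω : Space)) ⁻¹' C) :=
        hC.preimage (continuous_id.smul continuous_const).measurable
      simp_rw [hind F]
      have : ∀ r, ((fun r : ℝ => r • (ω : Space)) ⁻¹' C).indicator
          (fun r => F (r • (ω : Space))) r * ENNReal.ofReal (r ^ 2) =
          ((fun r : ℝ => r • (ω : Space)) ⁻¹' C).indicator
            (fun r => F (r • (ω : Space)) * ENNReal.ofReal (r ^ 2)) r := fun r =>
        (Set.indicator_mul_left _ _ (fun r => ENNReal.ofReal (r ^ 2)) (i := r)).symm
      simp_rw [this]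
      rw [lintegral_indicator hpre, Measure.restrict_restrict hpre, hS, inter_comm]
    rw [hset F₁ hF₁m, hset F₂ hF₂m]
    -- the ray bound on `S`
    have hlhs : ∫⁻ r in S, F₁ (r • (ω : Space)) * ENNReal.ofReal (r ^ 2) =
        ∫⁻ r in S, dysonPotential R₀ R r * ((‖f r‖₊ : ℝ≥0∞)) ^ 2 * ENNReal.ofReal (r ^ 2) :=
      setLIntegral_congr_fun hSm fun r hr => by simp only [hF₁, hf, hnorm r hr]
    have hrhs : ∫⁻ r in S, edensC v f r ≤
        ∫⁻ r in S, F₂ (r • (ω : Space)) * ENNReal.ofReal (r ^ 2) := by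
      refine setLIntegral_mono' hSm fun r hr => ?_
      rw [edensC, hfd r]
      simp only [hF₂, hf, hnorm r hr]
      gcongr
      exact nnnorm_fderiv_apply_sq_le_gradSqC ψ _ _ hω
    rw [hlhs]
    exact (ray_bound hv hR₀ hvan hR hSm hS0 hdown hfC).trans hrhs
  -- integrate over the sphere
  calc a * ∫⁻ x in C, F₁ x = a * ∫⁻ x, G₁ x := by rw [hG₁, lintegral_indicator hC]
    _ = a * ∫⁻ ω, (∫⁻ r in Ioi (0 : ℝ), G₁ (r • (ω : Space)) * ENNReal.ofReal (r ^ 2))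
          ∂sphereVol := by rw [lintegral_eq_lintegral_sphere G₁ hG₁m]
    _ ≤ ∫⁻ ω, a * (∫⁻ r in Ioi (0 : ℝ), G₁ (r • (ω : Space)) * ENNReal.ofReal (r ^ 2))
          ∂sphereVol := lintegral_const_mul_le _ _
    _ ≤ ∫⁻ ω, (∫⁻ r in Ioi (0 : ℝ), G₂ (r • (ω : Space)) * ENNReal.ofReal (r ^ 2))
          ∂sphereVol := lintegral_mono hray
    _ = ∫⁻ x, G₂ x := (lintegral_eq_lintegral_sphere G₂ hG₂m).symm
    _ = ∫⁻ x in C, F₂ x := by rw [hG₂, lintegral_indicator hC]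

/-- **Lemma 2.5 (general centre).** As `lemma25_zero`, for a measurable `C ⊆ ℝ³` star-shaped
with respect to a point `p` (e.g. convex with `p ∈ C`), with `U_R(|x - p|)` and `v(|x - p|)`
(translate by `p`). [cite: LSSY2005, Lemma 2.5 (2.36)] -/
theorem lemma25 (hv : Measurable v) (hR₀ : 0 ≤ R₀) (hvan : ∀ r, R₀ < r → v r = 0)
    (hR : R₀ < R) {C : Set Space} (hC : MeasurableSet C) (p : Space)
    (hstar : ∀ x ∈ C, ∀ t ∈ Ioo (0 : ℝ) 1, p + t • (x - p) ∈ C) {ψ : Space → ℂ}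
    (hψ : ContDiff ℝ 1 ψ) :
    scatteringLength v * ∫⁻ x in C, dysonPotential R₀ R ‖x - p‖ * ((‖ψ x‖₊ : ℝ≥0∞)) ^ 2 ≤
      ∫⁻ x in C, gradSqC ψ x + 2⁻¹ * v ‖x - p‖ * ((‖ψ x‖₊ : ℝ≥0∞)) ^ 2 := by
  set T : Space → Space := fun y => p + y with hT
  have hTmp : MeasurePreserving T volume volume := measurePreserving_add_left volume p
  set C' := T ⁻¹' C with hC'
  have hC'm : MeasurableSet C' := hC.preimage hTmp.measurable
  set ψ' : Space → ℂ := fun y => ψ (p + y) with hψ'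
  have hψ'c : ContDiff ℝ 1 ψ' := hψ.comp (contDiff_const.add contDiff_id)
  have hstar' : ∀ y ∈ C', ∀ t ∈ Ioo (0 : ℝ) 1, t • y ∈ C' := by
    intro y hy t ht
    have := hstar (p + y) hy t ht
    simpa [hC', hT, add_sub_cancel_left] using this
  have hgrad : ∀ y, gradSqC ψ' y = gradSqC ψ (p + y) := fun y => by
    simp only [gradSqC, hψ', fderiv_comp_add_left]
  have key := lemma25_zero hv hR₀ hvan hR hC'm hstar' hψ'c
  have hψm : Measurable ψ := hψ.continuous.measurable
  have hm1 : Measurable fun x : Space => dysonPotential R₀ R ‖x - p‖ * ((‖ψ x‖₊ : ℝ≥0∞)) ^ 2 :=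
    ((measurable_dysonPotential R₀ R).comp (measurable_norm.comp (measurable_id.sub_const p))).mul
      (by fun_prop)
  have hm2 : Measurable fun x : Space =>
      gradSqC ψ x + 2⁻¹ * v ‖x - p‖ * ((‖ψ x‖₊ : ℝ≥0∞)) ^ 2 :=
    (measurable_gradSqC hψ).add ((measurable_const.mul
      (hv.comp (measurable_norm.comp (measurable_id.sub_const p)))).mul (by fun_prop))
  have h1 : ∫⁻ x in C, dysonPotential R₀ R ‖x - p‖ * ((‖ψ x‖₊ : ℝ≥0∞)) ^ 2 =
      ∫⁻ y in C', dysonPotential R₀ R ‖y‖ * ((‖ψ' y‖₊ : ℝ≥0∞)) ^ 2 := by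
    rw [← hTmp.setLIntegral_comp_preimage hC hm1]
    refine setLIntegral_congr_fun hC'm fun y _ => ?_
    simp [hT, hψ']
  have h2 : ∫⁻ x in C, gradSqC ψ x + 2⁻¹ * v ‖x - p‖ * ((‖ψ x‖₊ : ℝ≥0∞)) ^ 2 =
      ∫⁻ y in C', gradSqC ψ' y + 2⁻¹ * v ‖y‖ * ((‖ψ' y‖₊ : ℝ≥0∞)) ^ 2 := by
    rw [← hTmp.setLIntegral_comp_preimage hC hm2]
    refine setLIntegral_congr_fun hC'm fun y _ => ?_
    rw [hgrad y]
    simp [hT, hψ']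
  rw [h1, h2]
  exact key

end Lemma25

/-! ### Freezing the other particles: the group of particle `i` alone -/

section Single

variable {n : ℕ}

/-- The configuration of one particle at `y`. [folklore] -/
theorem const_eq_single (w : Space) : (fun _ : Fin 1 => w) = Pi.single (0 : Fin 1) w := by
  funext m
  rw [Subsingleton.elim m 0, Pi.single_eq_same]

/-- The glued configuration with particle `i` at `y` has `xᵢ = y`. [folklore] -/
theorem glueEquiv_single_apply_self (i : Fin n) (y : Space)
    (Z : {k // k ∉ Set.range (singleEmb i)} → Space) :
    glueEquiv (singleEmb i) 0 ((fun _ => y), Z) i = y :=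
  (glueEquiv_apply_ι (singleEmb i) 0 (fun _ => y) Z 0).trans (zero_add _)

/-- The other particles of the glued configuration are the frozen ones. [folklore] -/
theorem glueEquiv_single_apply_of_ne (i : Fin n) (y : Space)
    (Z : {k // k ∉ Set.range (singleEmb i)} → Space) {j : Fin n} (hj : j ≠ i) :
    glueEquiv (singleEmb i) 0 ((fun _ => y), Z) j = Z ⟨j, not_mem_range_singleEmb hj⟩ :=
  glueEquiv_apply_of_not_mem _ 0 _ Z j _

/-- The group kinetic density of the singleton group `{i}` is `∑ₖ |∂_{i,k} ψ|²`. [folklore] -/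
theorem kineticOn_singleEmb (i : Fin n) (ψ : Config n → ℂ) (X : Config n) :
    kineticOn (singleEmb i) ψ X =
      ∑ k : Fin 3,
        ((‖fderiv ℝ ψ X (Pi.single i (EuclideanSpace.single k (1 : ℝ)))‖₊ : ℝ≥0∞)) ^ 2 := by
  simp [kineticOn]

/-- The kinetic density of a one-particle function `y ↦ φ(y)` written through `Config 1`:
`|∇(φ ∘ const)|²(y) = kineticDensity φ (const y)`. [folklore] -/
theorem gradSqC_comp_const {φ : Config 1 → ℂ} (hφ : Differentiable ℝ φ) (y : Space) :
    gradSqC (fun y : Space => φ (fun _ => y)) y = kineticDensity φ (fun _ => y) := by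
  set cL : Space →L[ℝ] Config 1 := ContinuousLinearMap.pi fun _ => ContinuousLinearMap.id ℝ Space
    with hcL
  have hcLy : ∀ w : Space, cL w = fun _ => w := fun w => rfl
  have h : HasFDerivAt (fun y : Space => φ (fun _ => y)) ((fderiv ℝ φ (fun _ => y)).comp cL) y :=
    (hφ _).hasFDerivAt.comp y cL.hasFDerivAt
  rw [gradSqC, h.fderiv, kineticDensity, Fin.sum_univ_one]
  refine Finset.sum_congr rfl fun k _ => ?_
  rw [ContinuousLinearMap.comp_apply, hcLy,
    show (fun _ : Fin 1 => EuclideanSpace.single k (1 : ℝ)) =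
      Pi.single (0 : Fin 1) (EuclideanSpace.single k (1 : ℝ)) from const_eq_single _]

/-- **Fubini for the singleton group.** Integrals over `Λ_ℓ^n` as iterated integrals over the
positions of the particles other than `i` and then over the position `y ∈ Λ_ℓ` of particle `i`
(through `glueEquiv (singleEmb i) 0` and `Config 1 ≃ ℝ³`). [folklore] -/
theorem setLIntegral_boxN_eq_glue (ℓ : ℝ) (i : Fin n) {F : Config n → ℝ≥0∞} (hF : Measurable F) :
    ∫⁻ X in boxN n ℓ, F X =
      ∫⁻ Z in Set.pi univ (fun _ : {k // k ∉ Set.range (singleEmb i)} => box ℓ),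
        ∫⁻ y in box ℓ, F (glueEquiv (singleEmb i) 0 ((fun _ => y), Z)) := by
  set e := glueEquiv (singleEmb i) 0 with he_def
  have he := volume_preserving_glueEquiv (singleEmb i) (0 : Space)
  set B := Set.pi univ (fun _ : {k // k ∉ Set.range (singleEmb i)} => box ℓ) with hB
  have hpre : e ⁻¹' boxN n ℓ = boxN 1 ℓ ×ˢ B := by
    ext ⟨Y, Z⟩
    simp only [mem_preimage, boxN, mem_setOf_eq, mem_prod, hB, mem_univ_pi]
    constructor
    · intro h
      refine ⟨fun m => ?_, fun j => ?_⟩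
      · have := h i
        rwa [Subsingleton.elim m 0, ← show e (Y, Z) i = Y 0 from
          (glueEquiv_apply_ι (singleEmb i) 0 Y Z 0).trans (zero_add _)]
      · have := h j
        rwa [he_def, glueEquiv_apply_of_not_mem _ 0 Y Z j j.2] at this
    · rintro ⟨hY, hZ⟩ j
      by_cases hj : j = i
      · subst hj
        rw [show e (Y, Z) j = Y 0 from (glueEquiv_apply_ι (singleEmb j) 0 Y Z 0).trans
          (zero_add _)]
        exact hY 0
      · rw [he_def, glueEquiv_apply_of_not_mem _ 0 Y Z j (not_mem_range_singleEmb hj)]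
        exact hZ ⟨j, _⟩
  rw [← he.setLIntegral_comp_preimage (measurableSet_boxN n ℓ) hF, hpre, Measure.volume_eq_prod,
    setLIntegral_prod_symm (fun p => F (e p)) (hF.comp e.measurable).aemeasurable]
  refine setLIntegral_congr_fun (MeasurableSet.univ_pi fun _ => measurableSet_box ℓ)
    fun Z _ => ?_
  -- `Config 1 ≃ ℝ³`
  set u := MeasurableEquiv.funUnique (Fin 1) Space with hu
  have hu_mp : MeasurePreserving u volume volume := volume_preserving_funUnique (Fin 1) Space
  have hu_symm : ∀ y : Space, u.symm y = fun _ => y := fun y => by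
    funext m; simp [hu, MeasurableEquiv.funUnique]
  have hpre1 : u ⁻¹' box ℓ = boxN 1 ℓ := by
    ext Y
    simp only [mem_preimage, boxN, mem_setOf_eq, hu]
    constructor
    · intro h m
      rw [Subsingleton.elim m 0]
      simpa [MeasurableEquiv.funUnique] using h
    · intro h
      simpa [MeasurableEquiv.funUnique] using h 0
  have hm : Measurable fun y : Space => F (e ((fun _ => y), Z)) :=
    hF.comp (e.measurable.comp ((measurable_pi_lambda _ fun _ => measurable_id).prodMk
      measurable_const))
  rw [← hpre1, ← hu_mp.setLIntegral_comp_preimage (measurableSet_box ℓ) hm]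
  refine setLIntegral_congr_fun (hpre1 ▸ measurableSet_boxN 1 ℓ) fun Y _ => ?_
  congr 2
  rw [← hu_symm, MeasurableEquiv.symm_apply_apply]

end Single

/-! ### Tie-breaking Voronoi cells -/

section Cells

variable {n : ℕ}

/-- The **Voronoi cell** (with ties broken by the index) of particle `j` among the particles
other than `i`, inside the box `Λ_ℓ`: the points `y ∈ Λ_ℓ` that are strictly closer to `X₀ j`
than to every `X₀ k` with `k < j`, and at least as close as to every `X₀ k` with `k > j`
(`k ≠ i`). These cells partition `Λ_ℓ` exactly and are convex.
[cite: LSSY2005, Cor. 2.6, proof (Voronoi cells)] -/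
def vcell (ℓ : ℝ) (i : Fin n) (X₀ : Config n) (j : Fin n) : Set Space :=
  box ℓ ∩ ⋂ (k : Fin n) (_ : k ≠ i),
    {y | (k < j → dist y (X₀ j) < dist y (X₀ k)) ∧ (j < k → dist y (X₀ j) ≤ dist y (X₀ k))}

/-- Membership in a cell. [folklore] -/
theorem mem_vcell {ℓ : ℝ} {i : Fin n} {X₀ : Config n} {j : Fin n} {y : Space} :
    y ∈ vcell ℓ i X₀ j ↔ y ∈ box ℓ ∧ ∀ k, k ≠ i →
      (k < j → dist y (X₀ j) < dist y (X₀ k)) ∧ (j < k → dist y (X₀ j) ≤ dist y (X₀ k)) := by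
  simp [vcell, mem_iInter]

/-- Cells lie in the box. [folklore] -/
theorem vcell_subset_box (ℓ : ℝ) (i : Fin n) (X₀ : Config n) (j : Fin n) :
    vcell ℓ i X₀ j ⊆ box ℓ := inter_subset_left

/-- Cells are measurable. [folklore] -/
theorem measurableSet_vcell (ℓ : ℝ) (i : Fin n) (X₀ : Config n) (j : Fin n) :
    MeasurableSet (vcell ℓ i X₀ j) := by
  refine (measurableSet_box ℓ).inter
    (MeasurableSet.iInter fun k => MeasurableSet.iInter fun _ => ?_)
  have h1 : Measurable fun y : Space => dist y (X₀ j) := measurable_id.dist measurable_const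
  have h2 : Measurable fun y : Space => dist y (X₀ k) := measurable_id.dist measurable_const
  have e : {y : Space | (k < j → dist y (X₀ j) < dist y (X₀ k)) ∧
      (j < k → dist y (X₀ j) ≤ dist y (X₀ k))} =
      {y | k < j → dist y (X₀ j) < dist y (X₀ k)} ∩
        {y | j < k → dist y (X₀ j) ≤ dist y (X₀ k)} := by
    ext y; simp
  rw [e]
  refine MeasurableSet.inter ?_ ?_
  · by_cases hkj : k < j
    · simp only [hkj, forall_const]; exact measurableSet_lt h1 h2
    · simp [hkj]
  · by_cases hjk : j < k
    · simp only [hjk, forall_const]; exact measurableSet_le h1 h2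
    · simp [hjk]

/-- Distinct cells are disjoint. [folklore] -/
theorem disjoint_vcell {ℓ : ℝ} {i : Fin n} {X₀ : Config n} {j j' : Fin n} (hj : j ≠ i)
    (hj' : j' ≠ i) (hne : j ≠ j') : Disjoint (vcell ℓ i X₀ j) (vcell ℓ i X₀ j') := by
  rw [Set.disjoint_left]
  intro y hy hy'
  rw [mem_vcell] at hy hy'
  rcases lt_or_gt_of_ne hne with h | h
  · exact absurd ((hy.2 j' hj').2 h) (not_le.2 ((hy'.2 j hj).1 h))
  · exact absurd ((hy'.2 j hj).2 h) (not_le.2 ((hy.2 j' hj').1 h))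

/-- **The cells cover**: the nearest neighbour of particle `i` (the one of smallest index among
the nearest) owns the cell containing `xᵢ`. [cite: LSSY2005, Cor. 2.6 (2.42)] -/
theorem exists_mem_vcell {ℓ : ℝ} (i : Fin n) (X : Config n) (hne : (Finset.univ.erase i).Nonempty)
    (hX : X i ∈ box ℓ) :
    ∃ j, j ≠ i ∧ X i ∈ vcell ℓ i X j ∧ nnDist X i = dist (X i) (X j) := by
  classical
  set m := nnDist X i with hm
  set S₀ := (Finset.univ.erase i).filter (fun k => dist (X i) (X k) = m) with hS₀
  obtain ⟨j₁, hj₁, hj₁eq⟩ := exists_nnDist_eq X i hne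
  have hS₀ne : S₀.Nonempty := ⟨j₁, by simp [hS₀, hj₁, hm, hj₁eq]⟩
  set j₀ := S₀.min' hS₀ne with hj₀
  have hj₀mem : j₀ ∈ S₀ := Finset.min'_mem _ _
  simp only [hS₀, Finset.mem_filter, Finset.mem_erase, Finset.mem_univ, and_true] at hj₀mem
  refine ⟨j₀, hj₀mem.1, ?_, hj₀mem.2.symm⟩
  rw [mem_vcell]
  refine ⟨hX, fun k hk => ⟨fun hkj => ?_, fun _ => ?_⟩⟩
  · have hle : m ≤ dist (X i) (X k) := nnDist_le_dist X hk
    rw [hj₀mem.2]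
    refine lt_of_le_of_ne hle fun heq => ?_
    have hkS : k ∈ S₀ := by simp [hS₀, hk, heq]
    exact absurd (Finset.min'_le S₀ k hkS) (not_le.2 hkj)
  · rw [hj₀mem.2]
    exact nnDist_le_dist X hk

/-- The box is convex along segments (coordinatewise). [folklore] -/
theorem add_smul_sub_mem_box {ℓ : ℝ} {a b : Space} (ha : a ∈ box ℓ) (hb : b ∈ box ℓ) {t : ℝ}
    (ht : t ∈ Ioo (0 : ℝ) 1) : a + t • (b - a) ∈ box ℓ := by
  intro k
  have h1 := ha k
  have h2 := hb k
  simp only [PiLp.add_apply, PiLp.smul_apply, PiLp.sub_apply, smul_eq_mul, mem_Ioo] at h1 h2 ⊢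
  constructor <;> nlinarith [ht.1, ht.2, h1.1, h1.2, h2.1, h2.2]

/-- **Cells are star-shaped** with respect to their centre (indeed convex): if `X₀ j ∈ Λ_ℓ`,
`x ∈ cell j` and `0 < t < 1` then `X₀ j + t(x - X₀ j) ∈ cell j` (triangle inequality).
[cite: LSSY2005, Cor. 2.6, proof ("these cells are star shaped w.r.t. xᵢ, indeed convex")] -/
theorem vcell_star {ℓ : ℝ} {i : Fin n} {X₀ : Config n} {j : Fin n} (hX₀ : X₀ j ∈ box ℓ)
    {x : Space} (hx : x ∈ vcell ℓ i X₀ j) {t : ℝ} (ht : t ∈ Ioo (0 : ℝ) 1) :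
    X₀ j + t • (x - X₀ j) ∈ vcell ℓ i X₀ j := by
  rw [mem_vcell] at hx ⊢
  set z := X₀ j + t • (x - X₀ j) with hz
  have hdz : dist z (X₀ j) = t * dist x (X₀ j) := by
    rw [hz, dist_eq_norm, dist_eq_norm, add_sub_cancel_left, norm_smul,
      Real.norm_of_nonneg ht.1.le]
  have hxz : dist x z = (1 - t) * dist x (X₀ j) := by
    rw [hz, dist_eq_norm, dist_eq_norm,
      show x - (X₀ j + t • (x - X₀ j)) = (1 - t) • (x - X₀ j) by
        rw [sub_smul, one_smul]; abel,
      norm_smul, Real.norm_of_nonneg (by linarith [ht.2])]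
  refine ⟨add_smul_sub_mem_box hX₀ hx.1 ht, fun k hk => ⟨fun hkj => ?_, fun hjk => ?_⟩⟩
  · have h := (hx.2 k hk).1 hkj
    have htri := dist_triangle x z (X₀ k)
    have hpos : 0 ≤ dist x (X₀ j) := dist_nonneg
    rw [hdz]
    nlinarith [ht.1, ht.2]
  · have h := (hx.2 k hk).2 hjk
    have htri := dist_triangle x z (X₀ k)
    have hpos : 0 ≤ dist x (X₀ j) := dist_nonneg
    rw [hdz]
    nlinarith [ht.1, ht.2]

end Cells

/-! ### Corollary 2.6: `H_n ≥ a W_R` in the box -/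

section Corollary

variable {v : ℝ → ℝ≥0∞} {R₀ R : ℝ} {n : ℕ}

/-- The integrand of the right side for particle `i`: its kinetic density (`kineticOn` of the
singleton group) plus half of its interactions. [cite: LSSY2005, Cor. 2.6, proof] -/
def rhsDensity (v : ℝ → ℝ≥0∞) (i : Fin n) (ψ : Config n → ℂ) (X : Config n) : ℝ≥0∞ :=
  kineticOn (singleEmb i) ψ X +
    2⁻¹ * (∑ j ∈ Finset.univ.erase i, v (dist (X i) (X j))) * ((‖ψ X‖₊ : ℝ≥0∞)) ^ 2

/-- `rhsDensity` is measurable. [folklore] -/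
theorem measurable_rhsDensity (hv : Measurable v) (i : Fin n) {ψ : Config n → ℂ}
    (hψ : ContDiff ℝ 1 ψ) : Measurable (rhsDensity v i ψ) := by
  unfold rhsDensity
  have h2 : ∀ j, Measurable fun X : Config n => v (dist (X i) (X j)) := fun j =>
    hv.comp ((measurable_config_apply i).dist (measurable_config_apply j))
  have h3 : Measurable fun X => ((‖ψ X‖₊ : ℝ≥0∞)) ^ 2 := by
    have := hψ.continuous.measurable; fun_prop
  exact (measurable_kineticOn _ hψ).add
    ((measurable_const.mul (Finset.measurable_sum _ fun j _ => h2 j)).mul h3)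

/-- The integrand of the left side for particle `i`: `U_R(tᵢ) |ψ|²`.
[cite: LSSY2005, Cor. 2.6 (2.41)] -/
def lhsDensity (R₀ R : ℝ) (i : Fin n) (ψ : Config n → ℂ) (X : Config n) : ℝ≥0∞ :=
  dysonPotential R₀ R (nnDist X i) * ((‖ψ X‖₊ : ℝ≥0∞)) ^ 2

/-- `lhsDensity` is measurable. [folklore] -/
theorem measurable_lhsDensity (R₀ R : ℝ) (i : Fin n) {ψ : Config n → ℂ} (hψ : ContDiff ℝ 1 ψ) :
    Measurable (lhsDensity R₀ R i ψ) := by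
  unfold lhsDensity
  have := hψ.continuous.measurable
  exact ((measurable_dysonPotential R₀ R).comp (continuous_nnDist i).measurable).mul (by fun_prop)

/-- **The slice bound.** Fix particle `i`, the positions `Z` of the others (all in `Λ_ℓ`), and
`ψ ∈ C¹`. Then, integrating over the position `y ∈ Λ_ℓ` of particle `i`,
`a ∫ U_R(tᵢ)|ψ|² dy ≤ ∫ (|∇ᵢψ|² + ½ ∑_{j≠i} v(|y - xⱼ|)|ψ|²) dy`: decompose `Λ_ℓ` into the
(tie-breaking) Voronoi cells of the other particles, apply Lemma 2.5 in each cell (star-shaped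
with respect to its centre) keeping only the nearest-neighbour term of the potential, and sum
(the cells are disjoint, `v ≥ 0`). [cite: LSSY2005, Cor. 2.6 (2.40)–(2.42)] -/
theorem slice_bound (hv : Measurable v) (hR₀ : 0 ≤ R₀) (hvan : ∀ r, R₀ < r → v r = 0)
    (hR : R₀ < R) {ℓ : ℝ} (i : Fin n) {ψ : Config n → ℂ} (hψ : ContDiff ℝ 1 ψ)
    (Z : {k // k ∉ Set.range (singleEmb i)} → Space) (hZ : ∀ j, Z j ∈ box ℓ) :
    scatteringLength v *
        ∫⁻ y in box ℓ, lhsDensity R₀ R i ψ (glueEquiv (singleEmb i) 0 ((fun _ => y), Z)) ≤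
      ∫⁻ y in box ℓ, rhsDensity v i ψ (glueEquiv (singleEmb i) 0 ((fun _ => y), Z)) := by
  classical
  set a := scatteringLength v with ha
  set e := glueEquiv (singleEmb i) 0 with he
  set X₀ : Config n := e ((fun _ => 0), Z) with hX₀
  set φ : Space → ℂ := fun y => ψ (e ((fun _ => y), Z)) with hφ
  have hsl : ∀ y, φ y = slice (singleEmb i) 0 ψ Z (fun _ => y) := fun y => rfl
  have hφc : ContDiff ℝ 1 φ :=
    (contDiff_slice (singleEmb i) 0 hψ Z).comp (contDiff_pi.2 fun _ => contDiff_id)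
  have hφm : Measurable φ := hφc.continuous.measurable
  set J := Finset.univ.erase i with hJ
  set c : Fin n → Set Space := vcell ℓ i X₀ with hc
  have hcm : ∀ j, MeasurableSet (c j) := measurableSet_vcell ℓ i X₀
  have hXself : ∀ y, e ((fun _ => y), Z) i = y := fun y => glueEquiv_single_apply_self i y Z
  have hX : ∀ y (k : Fin n) (hk : k ≠ i), e ((fun _ => y), Z) k = X₀ k := fun y k hk => by
    rw [hX₀, he, glueEquiv_single_apply_of_ne i y Z hk, glueEquiv_single_apply_of_ne i 0 Z hk]
  have hX₀box : ∀ j, j ≠ i → X₀ j ∈ box ℓ := fun j hj => by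
    rw [hX₀, he, glueEquiv_single_apply_of_ne i 0 Z hj]; exact hZ _
  -- the kinetic density of `φ` is the group kinetic density of `ψ`
  have hkin : ∀ y, gradSqC φ y = kineticOn (singleEmb i) ψ (e ((fun _ => y), Z)) := by
    intro y
    rw [show φ = fun y : Space => slice (singleEmb i) 0 ψ Z (fun _ => y) from funext hsl,
      gradSqC_comp_const ((contDiff_slice (singleEmb i) 0 hψ Z).differentiable one_ne_zero),
      kineticDensity_slice (singleEmb i) 0 hψ Z]
  -- the integrands in terms of `φ` and `X₀`
  set G : Fin n → Space → ℝ≥0∞ := fun j y =>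
    dysonPotential R₀ R (dist y (X₀ j)) * ((‖φ y‖₊ : ℝ≥0∞)) ^ 2 with hG
  have hGm : ∀ j, Measurable (G j) := fun j =>
    ((measurable_dysonPotential R₀ R).comp (measurable_id.dist measurable_const)).mul (by fun_prop)
  -- step 1: pointwise cover
  have hcover : ∀ y ∈ box ℓ, lhsDensity R₀ R i ψ (e ((fun _ => y), Z)) ≤
      ∑ j ∈ J, (c j).indicator (G j) y := by
    intro y hy
    by_cases hJne : J.Nonempty
    · obtain ⟨j₀, hj₀, hmem, hdist⟩ := exists_mem_vcell i (e ((fun _ => y), Z)) hJne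
        (by rwa [hXself])
      have hcell : vcell ℓ i (e ((fun _ => y), Z)) j₀ = c j₀ := by
        simp only [hc, vcell]
        congr 1
        refine iInter_congr fun k => iInter_congr fun hk => ?_
        rw [hX y k hk, hX y j₀ hj₀]
      rw [hXself, hcell] at hmem
      rw [hXself, hX y j₀ hj₀] at hdist
      calc lhsDensity R₀ R i ψ (e ((fun _ => y), Z)) = G j₀ y := by
            simp only [lhsDensity, hG, hdist, hφ]
        _ = (c j₀).indicator (G j₀) y := (indicator_of_mem hmem _).symm
        _ ≤ ∑ j ∈ J, (c j).indicator (G j) y :=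
            Finset.single_le_sum (f := fun j => (c j).indicator (G j) y) (fun _ _ => zero_le)
              (Finset.mem_erase.2 ⟨hj₀, Finset.mem_univ _⟩)
    · have : nnDist (e ((fun _ => y), Z)) i = 0 := by rw [nnDist, dif_neg hJne]
      simp [lhsDensity, this, dysonPotential_zero_of_nonneg hR₀]
  -- step 2: integrate the cover and apply Lemma 2.5 in each cell
  have hstep2 : a * ∫⁻ y in box ℓ, lhsDensity R₀ R i ψ (e ((fun _ => y), Z)) ≤
      ∑ j ∈ J, ∫⁻ y in c j, gradSqC φ y + 2⁻¹ * v ‖y - X₀ j‖ * ((‖φ y‖₊ : ℝ≥0∞)) ^ 2 := by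
    calc a * ∫⁻ y in box ℓ, lhsDensity R₀ R i ψ (e ((fun _ => y), Z))
        ≤ a * ∫⁻ y in box ℓ, ∑ j ∈ J, (c j).indicator (G j) y :=
          mul_le_mul' le_rfl (setLIntegral_mono' (measurableSet_box ℓ) hcover)
      _ = a * ∑ j ∈ J, ∫⁻ y in box ℓ, (c j).indicator (G j) y := by
          rw [lintegral_finsetSum _ fun j _ => (hGm j).indicator (hcm j)]
      _ = ∑ j ∈ J, a * ∫⁻ y in c j, G j y := by
          rw [Finset.mul_sum]
          refine Finset.sum_congr rfl fun j _ => ?_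
          rw [lintegral_indicator (hcm j), Measure.restrict_restrict (hcm j),
            inter_eq_left.2 (vcell_subset_box ℓ i X₀ j)]
      _ ≤ _ := by
          refine Finset.sum_le_sum fun j hj => ?_
          have hji : j ≠ i := (Finset.mem_erase.1 hj).1
          have := lemma25 hv hR₀ hvan hR (hcm j) (X₀ j)
            (fun x hx t ht => vcell_star (hX₀box j hji) hx ht) hφc
          simpa only [hG, dist_eq_norm] using this
  -- step 3: recombine
  have hunion : (⋃ j ∈ J, c j) ⊆ box ℓ := iUnion₂_subset fun j _ => vcell_subset_box ℓ i X₀ j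
  have hdisj : Set.PairwiseDisjoint (↑J : Set (Fin n)) c := fun j hj j' hj' hne =>
    disjoint_vcell (Finset.mem_erase.1 hj).1 (Finset.mem_erase.1 hj').1 hne
  have hvm : ∀ j, Measurable fun y : Space => 2⁻¹ * v ‖y - X₀ j‖ * ((‖φ y‖₊ : ℝ≥0∞)) ^ 2 :=
    fun j => (measurable_const.mul (hv.comp (measurable_id.sub_const _).norm)).mul (by fun_prop)
  have hstep3 : ∑ j ∈ J, ∫⁻ y in c j, gradSqC φ y + 2⁻¹ * v ‖y - X₀ j‖ * ((‖φ y‖₊ : ℝ≥0∞)) ^ 2 ≤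
      ∫⁻ y in box ℓ, gradSqC φ y + ∑ j ∈ J, 2⁻¹ * v ‖y - X₀ j‖ * ((‖φ y‖₊ : ℝ≥0∞)) ^ 2 := by
    calc ∑ j ∈ J, ∫⁻ y in c j, gradSqC φ y + 2⁻¹ * v ‖y - X₀ j‖ * ((‖φ y‖₊ : ℝ≥0∞)) ^ 2
        = ∑ j ∈ J, ((∫⁻ y in c j, gradSqC φ y) +
            ∫⁻ y in c j, 2⁻¹ * v ‖y - X₀ j‖ * ((‖φ y‖₊ : ℝ≥0∞)) ^ 2) :=
          Finset.sum_congr rfl fun j _ => lintegral_add_left (measurable_gradSqC hφc) _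
      _ = (∑ j ∈ J, ∫⁻ y in c j, gradSqC φ y) +
            ∑ j ∈ J, ∫⁻ y in c j, 2⁻¹ * v ‖y - X₀ j‖ * ((‖φ y‖₊ : ℝ≥0∞)) ^ 2 :=
          Finset.sum_add_distrib
      _ ≤ (∫⁻ y in box ℓ, gradSqC φ y) +
            ∑ j ∈ J, ∫⁻ y in box ℓ, 2⁻¹ * v ‖y - X₀ j‖ * ((‖φ y‖₊ : ℝ≥0∞)) ^ 2 := by
          refine add_le_add ?_ (Finset.sum_le_sum fun j _ =>
            lintegral_mono_set (vcell_subset_box ℓ i X₀ j))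
          rw [← lintegral_biUnion_finset hdisj fun j _ => hcm j]
          exact lintegral_mono_set hunion
      _ = _ := by
          rw [← lintegral_finsetSum _ fun j _ => hvm j,
            ← lintegral_add_left (measurable_gradSqC hφc)]
  -- step 4: identify the right side
  have hrhs : ∀ y, rhsDensity v i ψ (e ((fun _ => y), Z)) =
      gradSqC φ y + ∑ j ∈ J, 2⁻¹ * v ‖y - X₀ j‖ * ((‖φ y‖₊ : ℝ≥0∞)) ^ 2 := by
    intro y
    rw [rhsDensity, hkin y, Finset.mul_sum, Finset.sum_mul]
    congr 1
    refine Finset.sum_congr rfl fun j hj => ?_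
    rw [hXself, hX y j (Finset.mem_erase.1 hj).1, dist_eq_norm]
  calc a * ∫⁻ y in box ℓ, lhsDensity R₀ R i ψ (e ((fun _ => y), Z)) ≤ _ := hstep2
    _ ≤ _ := hstep3
    _ = ∫⁻ y in box ℓ, rhsDensity v i ψ (e ((fun _ => y), Z)) :=
        lintegral_congr fun y => (hrhs y).symm

/-- **Corollary 2.6, one particle.** For every `i` and `ψ ∈ C¹`,
`a ∫_{Λ^n} U_R(tᵢ)|ψ|² ≤ ∫_{Λ^n} (|∇ᵢψ|² + ½ ∑_{j≠i} v(|xᵢ - xⱼ|)|ψ|²)`.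
[cite: LSSY2005, Cor. 2.6 (2.40)] -/
theorem particle_bound (hv : Measurable v) (hR₀ : 0 ≤ R₀) (hvan : ∀ r, R₀ < r → v r = 0)
    (hR : R₀ < R) (ℓ : ℝ) (i : Fin n) {ψ : Config n → ℂ} (hψ : ContDiff ℝ 1 ψ) :
    scatteringLength v * ∫⁻ X in boxN n ℓ, lhsDensity R₀ R i ψ X ≤
      ∫⁻ X in boxN n ℓ, rhsDensity v i ψ X := by
  set B := Set.pi univ (fun _ : {k // k ∉ Set.range (singleEmb i)} => box ℓ) with hB
  have hBm : MeasurableSet B := MeasurableSet.univ_pi fun _ => measurableSet_box ℓ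
  rw [setLIntegral_boxN_eq_glue ℓ i (measurable_lhsDensity R₀ R i hψ),
    setLIntegral_boxN_eq_glue ℓ i (measurable_rhsDensity hv i hψ)]
  refine (lintegral_const_mul_le _ _).trans (setLIntegral_mono' hBm fun Z hZ => ?_)
  exact slice_bound hv hR₀ hvan hR i hψ Z (fun j => hZ j (mem_univ _))

/-- `∑ᵢ ∑_{j ≠ i} v(|xᵢ - xⱼ|) = 2 ∑_{i<j} v(|xᵢ - xⱼ|)`. [folklore] -/
theorem sum_sum_erase_eq_two_mul_interaction (v : ℝ → ℝ≥0∞) (X : Config n) :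
    ∑ i, ∑ j ∈ Finset.univ.erase i, v (dist (X i) (X j)) = 2 * interaction v X := by
  classical
  have hsplit : ∀ i : Fin n, Finset.univ.erase i =
      (Finset.univ.filter fun j => i < j) ∪ Finset.univ.filter fun j => j < i := by
    intro i; ext j
    simp only [Finset.mem_erase, Finset.mem_univ, and_true, Finset.mem_union, Finset.mem_filter,
      true_and]
    exact ⟨fun h => (lt_or_gt_of_ne h).symm, fun h => h.elim ne_of_gt ne_of_lt⟩
  have hdisj : ∀ i : Fin n, Disjoint (Finset.univ.filter fun j => i < j)
      (Finset.univ.filter fun j => j < i) := by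
    intro i
    rw [Finset.disjoint_filter]
    exact fun j _ h h' => lt_asymm h h'
  have h1 : ∑ i, ∑ j ∈ Finset.univ.erase i, v (dist (X i) (X j)) =
      (∑ i, ∑ j ∈ Finset.univ.filter (fun j => i < j), v (dist (X i) (X j))) +
        ∑ i, ∑ j ∈ Finset.univ.filter (fun j => j < i), v (dist (X i) (X j)) := by
    rw [← Finset.sum_add_distrib]
    exact Finset.sum_congr rfl fun i _ => by rw [hsplit i, Finset.sum_union (hdisj i)]
  have h2 : ∑ i, ∑ j ∈ Finset.univ.filter (fun j => j < i), v (dist (X i) (X j)) =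
      ∑ j, ∑ i ∈ Finset.univ.filter (fun i => j < i), v (dist (X i) (X j)) :=
    Finset.sum_comm' fun i j => by simp
  have h3 : ∑ j, ∑ i ∈ Finset.univ.filter (fun i => j < i), v (dist (X i) (X j)) =
      ∑ j, ∑ i ∈ Finset.univ.filter (fun i => j < i), v (dist (X j) (X i)) := by
    simp_rw [dist_comm]
  rw [h1, h2, h3, two_mul]
  rfl

/-- **Corollary 2.6 in the box**: `H_n ≥ a W_R` as quadratic forms on `C¹(Λ_ℓ^n)`, i.e. the
named fact `LSSY2005_dysonBound_boxN`.
[cite: LSSY2005, Lemma 2.5 (2.36) and Cor. 2.6 (2.40)–(2.43)] -/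
theorem dysonBound_boxN_holds : LSSY2005_dysonBound_boxN := by
  intro v R₀ hv hR₀ hvan _ n ℓ R hR ψ hψ
  classical
  set a := scatteringLength v with ha
  have hψm : Measurable ψ := hψ.continuous.measurable
  have hlhs : ∀ X, dysonW R₀ R X * ((‖ψ X‖₊ : ℝ≥0∞)) ^ 2 = ∑ i, lhsDensity R₀ R i ψ X := fun X => by
    simp only [dysonW, lhsDensity, Finset.sum_mul]
  have hrhs : ∀ X, ∑ i, rhsDensity v i ψ X =
      kineticDensity ψ X + interaction v X * ((‖ψ X‖₊ : ℝ≥0∞)) ^ 2 := fun X => by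
    simp only [rhsDensity, kineticOn_singleEmb, Finset.sum_add_distrib, kineticDensity]
    congr 1
    rw [← Finset.sum_mul, ← Finset.mul_sum, sum_sum_erase_eq_two_mul_interaction, ← mul_assoc,
      ENNReal.inv_mul_cancel two_ne_zero ENNReal.ofNat_ne_top, one_mul]
  calc a * ∫⁻ X in boxN n ℓ, dysonW R₀ R X * ((‖ψ X‖₊ : ℝ≥0∞)) ^ 2
      = a * ∑ i, ∫⁻ X in boxN n ℓ, lhsDensity R₀ R i ψ X := by
        simp_rw [hlhs]
        rw [lintegral_finsetSum _ fun i _ => measurable_lhsDensity R₀ R i hψ]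
    _ = ∑ i, a * ∫⁻ X in boxN n ℓ, lhsDensity R₀ R i ψ X := Finset.mul_sum _ _ _
    _ ≤ ∑ i, ∫⁻ X in boxN n ℓ, rhsDensity v i ψ X :=
        Finset.sum_le_sum fun i _ => particle_bound hv hR₀ hvan hR ℓ i hψ
    _ = ∫⁻ X in boxN n ℓ, ∑ i, rhsDensity v i ψ X :=
        (lintegral_finsetSum _ fun i _ => measurable_rhsDensity hv i hψ).symm
    _ = ∫⁻ X in boxN n ℓ, kineticDensity ψ X + interaction v X * ((‖ψ X‖₊ : ℝ≥0∞)) ^ 2 :=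
        lintegral_congr fun X => hrhs X

end Corollary

end Dyson

/-- **Dyson's lemma in the box** — the named fact `LSSY2005_dysonBound_boxN` holds.
[cite: LSSY2005, Lemma 2.5 (2.36) and Cor. 2.6 (2.40)–(2.43)] -/
theorem LSSY2005_dysonBound_boxN_holds : LSSY2005_dysonBound_boxN := Dyson.dysonBound_boxN_holds

end Literature.MathematicalPhysics.QuantumManyBody.BoseGas

end
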